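import Literature.NumberTheory.Sieve.FriedlanderIwaniecPrimesSectorTrivial
import Literature.NumberTheory.Sieve.FriedlanderIwaniecPrimesGaussianForm
import Literature.NumberTheory.Sieve.FriedlanderIwaniecPrimesAngularPartition
import Literature.NumberTheory.Sieve.FriedlanderIwaniecPrimesBilinearCounting
import Literature.NumberTheory.Sieve.FriedlanderIwaniecPrimesDivisorLemma
import Literature.NumberTheory.Sieve.LinearEquationsInPrimesDivisorMoments
import HarnessLib

/-!
# Friedlander–Iwaniec, *The polynomial `X² + Y⁴` captures its primes*, §5: counting lemmas, splitting identities and the bounds behind (5.10)–(5.16)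

Family `parity`, statement parity.S17 (`setOf_prime_sq_add_pow_four_infinite`). Source: J. Friedlander,
H. Iwaniec, Ann. of Math. (2) 148 (1998), 945–1040 [FriedlanderIwaniecAnnals1998], §5 "The bilinear
form in the sieve: Transformations", pp. 962–964 ((5.6)–(5.16)), with §4 (4.11)–(4.23).

This is the toolbox of the PROVED reduction of (4.23) to (5.15) (sequel:
`FriedlanderIwaniecPrimesSectorReduction`, theorem `FriedlanderIwaniec1998_bilinBound_of_sectorBound`).
Everything here is PROVED; there are no named facts. Three parts.

**Part 1 — counting** (the proof of (5.10): "Put `ur + vs = c²` with `|c| ≤ 2(MN)^{1/4}`. Given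
`c, r, s` the residue class of `u (mod ps/(c, p))` is fixed and then `v` is determined. Therefore the
number of points `w = u + iv` is bounded by `O(1 + √M (c, p)/ps)` …"; and the trivial bound (5.16)
"`ℬ(M, N) ≪ Σ_{M < u²+v² ≤ 2M} Σ_{r+is ∈ 𝔅, ur+vs = □} |β(r²+s²)| ≪ M^{3/4} N^{-1/4} Σ |β(r²+s²)|. By
Lemma 2.2 `|β(r²+s²)| ≤ τ(r²+s²) ≤ 9 Σ_{d ∣ (r²+s²), d ≤ N^{1/3}} τ(d)`. Given such a `d`, we have
`#{r+is ∈ 𝔅 ; r²+s² ≡ 0 (d)} ≪ θ²N ρ(d) d⁻¹` … We can assume that `|φ (mod π/2)| > πϑ` because the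
other sectors, altogether of angle `≤ 2πϑ`, contribute no more than the bound (4.23) by the estimate
(5.16)"). The near-axis version of the lattice count is worked out explicitly (the source only says
"by the estimate (5.16)"; the sibling file `…SectorTrivial` proves (5.16) itself for one polar box):
the near-axis part of the annulus `Y₁ < r² + s² ≤ Y₂` is covered by the strips `|s| ≤ W`, `|r| ≤ W`,
each fibred over the small coordinate; on each fibre the points with `d ∣ r² + s²` in the radial run
of length `≤ (Y₂ - Y₁)/√(2Y₁) + 1` are counted in `N(d, -s²) ≤ τ(d)` residue classes.
* Lines in a disc: `card_le_of_line` / `card_le_of_line'`, `card_filter_line_le`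
  (`≤ 2⌊√X⌋/max(|r|,|s|) + 1` points of `u² + v² ≤ X` on `ur + vs = k`, `(r, s) = 1`);
  `fiZeta_eq_card_Icc`, `natAbs_le_of_sq_eq_line`, `sum_fiZeta_eq_sum_card`, **`sum_fiZeta_line_le`**;
  the congruence of (5.10): `not_dvd_of_prime_dvd_sq_add_sq`, `dvd_sub_of_line_of_dvd_norm`
  (`2ru ≡ c² (mod p)`), `card_Icc_filter_dvd_le`, **`sum_fiZeta_line_dvd_le`**.
* Near-axis lattice counts: `card_Icc_filter_dvd_sq_add_le''`, `circRadius` (+ lemmas),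
  `card_circFibre_le`, `circRadius_sub_le`, `nearAxisSet`, `axisStrip`, `card_nearAxisSet_filter_le`,
  `card_axisStrip_le`, **`card_nearAxisSet_filter_dvd_le`**, **`sum_nearAxis_tau_le`**
  (`Σ_{near-axis, r²+s² squarefree} τ(r²+s²) ≤ 18(2W+1)(1+log D)⁴(2(Y₂-Y₁)/√(2Y₁) + 5D)`, from
  Lemma 2.2 `card_divisors_le_nine_mul_sum` and `Σ_{d≤D} τ(d)²/d ≤ (1+log D)⁴` = `divPowSum_le`).
* Angles: `exists_abs_sub_mul_pi_div_two_le` (a sector NOT certified off-axis lies within `ϑ' + w`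
  of an axis), `abs_re_le_or_abs_im_le_of_arg` (`arg z` near a multiple of `π/2` ⇒ a coordinate is
  `≤ ϖ|z|`). Glue: `wAnnulus`, `sum_Ioc_sum_sqPairs`, `le_two_mul_max_natAbs_sq`,
  `sum_card_primaryNormEq_le`, `sum_le_sum_of_injOn_real`, `sum_card_primary_filter_le`.

**Part 2 — the splitting identities (5.6)–(5.13)** ("(5.7) … This can be accomplished by splitting
`B*(M, N)` into eight such classes"; "adding `B̃(M, N)` to `B*(M, N)` we conclude that (5.10)
`B*(M, N) = B(M, N) + O(…)` where `B(M, N)` is the free bilinear form"; "(5.12) … splitting according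
to a smooth partition of unity (without any residual contribution because there is no boundary)").
* `fiFreeSector α q p M N' θ C P τ` (the free form with the angular weight `q` of (5.13)),
  `fiGaussCompl` (the complementary form `B̃`), `fiGaussStar_add_fiGaussCompl` (`B* + B̃ = B`),
  `fiFreeSector_add`, `fiFreeSector_sum`, `fiGaussSector_const_mul`; `gaussReps8`, `gaussRep8`,
  `card_gaussReps8_le`, `sum_gaussReps8_ite`, `sum_gaussReps8_sum_filter`,
  **`fiFreeSector_eq_sum_fiGaussSector`** ((5.7), all `64` classes `z₀ (mod 8)`, the non-primary ones
  being empty), **`fiFreeSector_one_eq_sum_angPiece`** ((5.12), with `Σ_j angPiece θ j = 1` of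
  `…AngularPartition`); `norm_fiFreeSector_le`, `norm_fiGaussCompl_le` (absolute values, `w`-sums over
  `wAnnulus`).

**Part 3 — the three bounds.**
* `of_fiBeta_ne_zero`, `inner_sum_fiZeta_le` (`Σ_{w} 𝔷(Re w̄ z) ≤ (2(X₂Y₂)^{1/4}+1)(2√X₂/√(Y₁/2)+1)`);
  **`norm_fiFreeSector_nearAxis_le`** (near-axis total); `sum_filter_not_coprime_le`,
  `sum_filter_dvd_fiZeta_le`, **`norm_fiGaussCompl_le_explicit`** ((5.10):
  `‖B̃‖ ≤ τ²(2√Y₂+1)²[(2T₀+1)(2√X₂/(Pq₀)+1) + (2T₀/P+1)(2√X₂/q₀+1)]`);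
* `SectorBoundAt K ϑ θ M N N' C P τ p` — the shape of (5.15) at fixed outer data, and
  `Sector515At x P N C A₂ θ τ ϑ K` — its form over the (4.19)-range, the §5 twin of `BilinBoundAt`
  (`…BilinearReduction`); both are parametrised predicates (hypothesis shapes), not claims;
  **`norm_fiFreeSector_angPiece_le`** (an off-axis arc through (5.15): `≤ 64 · 2M_ψ · Kϑθ²(MN)^{3/4}(log MN)⁴`),
  **`norm_fiBilinearStar_le_split`** (`‖B*‖ ≤ Σ_{j ∈ G}‖B_{q_j}‖ + ‖B_{q_bad}‖ + ‖B̃‖`).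

## References

* J. Friedlander, H. Iwaniec, Ann. of Math. (2) 148 (1998), 945–1040, §5 (5.6)–(5.16), Lemma 2.2,
  §4 (4.11)–(4.23). [FriedlanderIwaniecAnnals1998]

## Tree / Mathlib

Tree: `fiZeta`, `sqPairs`, `toGauss` (`…GaussianParam`); `fiGaussStar`, `fiBilinearStar_eq_fiGaussStar`
(`…GaussianForm`); `fiGaussSector`, `gaussArg`, `GaussCongrEight` (`…GaussianSector`); `angPiece`,
`sum_angPiece`, `angPiece_support`, `abs_deriv_angPiece_le`, `abs_deriv_deriv_angPiece_le`
(`…AngularPartition`); `re_star_toGauss_mul`, `isCoprime_re_im_of_squarefree`,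
`abs_fiBeta_le_card_divisors` (`…SectorTrivial`); `card_Icc_filter_dvd_sub_le'`,
`sqCongrCount_le_card_divisors_of_squarefree` (`…BilinearCounting`); `card_divisors_le_nine_mul_sum`
(`…DivisorLemma`); `divPowSum_le` (`LinearEquationsInPrimesDivisorMoments`); `fiBox`,
`mem_Icc_sqrt_of_sq_le`, `mem_Icc_sqrt_sqrt_of_pow_four_le` (`FriedlanderIwaniecPrimes`);
`primaryNormEq` (`QuadraticFields.GaussianPrimary`). Mathlib: `IsCoprime.dvd_of_dvd_mul_right`,
`IsCoprime.mul_dvd`, `Prime.coprime_iff_not_dvd`, `Real.nat_sqrt_le_real_sqrt`,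
`Real.real_sqrt_lt_nat_sqrt_succ`, `Real.sin_add_int_mul_pi`, `Real.cos_add_int_mul_pi`,
`Real.cos_add_pi_div_two`, `Real.abs_sin_le_abs`, `Complex.norm_mul_cos_arg`, `Complex.norm_mul_sin_arg`.
-/

noncomputable section

open Finset Real Filter
open Literature.NumberTheory.QuadraticFields.GaussianPrimary

namespace Literature.NumberTheory.Sieve.FriedlanderIwaniecPrimes

/-! ### Lattice points on a line inside a disc -/

/-- `u² ≤ X` puts `u` in `[-⌊√X⌋, ⌊√X⌋]`. [folklore] -/
theorem mem_Icc_sqrt_of_sq_add_sq_le {u v : ℤ} {X : ℕ} (h : u ^ 2 + v ^ 2 ≤ (X : ℤ)) :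
    u ∈ Icc (-(Nat.sqrt X : ℤ)) (Nat.sqrt X) :=
  mem_Icc_sqrt_of_sq_le (by nlinarith [sq_nonneg v])

/-- **Points of a line in a disc, one residue class.** Let `F` be a set of lattice points
`(u, v)` with `u² + v² ≤ X`, all on one line `u r + v s = k` with `s ≠ 0`, `(r, s) = 1`, and all `u`
mutually congruent modulo `e ≥ 1`, `(e, s) = 1`. Then `u` determines the point, and the `u` that
occur lie in one residue class modulo `e|s|` inside `[-√X, √X]`; hence
`#F ≤ 2⌊√X⌋/(e|s|) + 1` ("the residue class of `u (mod ps/(c, p))` is fixed and then `v` is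
determined. Therefore the number of points `w = u + iv` is bounded by `O(1 + √M (c, p)/ps)`").
[cite: FriedlanderIwaniecAnnals1998, §5, proof of (5.10)] -/
theorem card_le_of_line {F : Finset (ℤ × ℤ)} {X : ℕ}
    (hF : ∀ uv ∈ F, uv.1 ^ 2 + uv.2 ^ 2 ≤ (X : ℤ))
    {r s k : ℤ} (hs : s ≠ 0) (hrs : IsCoprime r s)
    (hline : ∀ uv ∈ F, uv.1 * r + uv.2 * s = k)
    {e : ℕ} (he : 0 < e) (hes : IsCoprime (e : ℤ) s)
    (hmod : ∀ uv ∈ F, ∀ uv' ∈ F, (e : ℤ) ∣ uv.1 - uv'.1) :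
    #F ≤ 2 * Nat.sqrt X / (e * s.natAbs) + 1 := by
  rcases F.eq_empty_or_nonempty with hF0 | ⟨uv₀, h₀⟩
  · simp [hF0]
  set R : ℤ := (Nat.sqrt X : ℤ) with hR
  set q : ℕ := e * s.natAbs with hq
  have hq0 : 0 < q := Nat.mul_pos he (Int.natAbs_pos.mpr hs)
  have hqz : (q : ℤ) = (((e : ℤ) * s).natAbs : ℤ) := by
    rw [hq, Int.natAbs_mul, Int.natAbs_natCast]
  have h1 : #F ≤ #{a ∈ Icc (-R) R | (q : ℤ) ∣ a - uv₀.1} := by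
    refine card_le_card_of_injOn (fun uv => uv.1) ?_ ?_
    · intro uv huv
      have huv' : uv ∈ F := mem_coe.mp huv
      refine mem_coe.mpr (mem_filter.mpr ⟨mem_Icc_sqrt_of_sq_add_sq_le (hF uv huv'), ?_⟩)
      -- `s ∣ (u - u₀)` from the line, `e ∣ (u - u₀)` by hypothesis
      have hl := hline uv huv'
      have hl₀ := hline uv₀ h₀
      have hsd : s ∣ (uv.1 - uv₀.1) * r := by
        refine ⟨-(uv.2 - uv₀.2), ?_⟩
        linear_combination hl - hl₀
      have hsd' : s ∣ uv.1 - uv₀.1 := (IsCoprime.symm hrs).dvd_of_dvd_mul_right hsd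
      have hed : (e : ℤ) ∣ uv.1 - uv₀.1 := hmod uv huv' uv₀ h₀
      have hmul : (e : ℤ) * s ∣ uv.1 - uv₀.1 := IsCoprime.mul_dvd hes hed hsd'
      rw [hqz]
      exact Int.natAbs_dvd.mpr hmul
    · intro uv huv uv' huv' h
      have hl := hline uv (mem_coe.mp huv)
      have hl' := hline uv' (mem_coe.mp huv')
      simp only at h
      have h2 : uv.2 * s = uv'.2 * s := by linear_combination hl - hl' - h * r
      exact Prod.ext h (mul_right_cancel₀ hs h2)
  calc #F ≤ #{a ∈ Icc (-R) R | (q : ℤ) ∣ a - uv₀.1} := h1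
    _ ≤ (R - -R).toNat / q + 1 := card_Icc_filter_dvd_sub_le' hq0 _ _ _
    _ = 2 * Nat.sqrt X / (e * s.natAbs) + 1 := by
        congr 2
        rw [hR, show (Nat.sqrt X : ℤ) - -(Nat.sqrt X : ℤ) = ((2 * Nat.sqrt X : ℕ) : ℤ) by push_cast; ring,
          Int.toNat_natCast]

/-- The same with the roles of the coordinates exchanged (`r ≠ 0`, congruences on `v`).
[cite: FriedlanderIwaniecAnnals1998, §5, proof of (5.10)] -/
theorem card_le_of_line' {F : Finset (ℤ × ℤ)} {X : ℕ}
    (hF : ∀ uv ∈ F, uv.1 ^ 2 + uv.2 ^ 2 ≤ (X : ℤ))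
    {r s k : ℤ} (hr : r ≠ 0) (hrs : IsCoprime r s)
    (hline : ∀ uv ∈ F, uv.1 * r + uv.2 * s = k)
    {e : ℕ} (he : 0 < e) (her : IsCoprime (e : ℤ) r)
    (hmod : ∀ uv ∈ F, ∀ uv' ∈ F, (e : ℤ) ∣ uv.2 - uv'.2) :
    #F ≤ 2 * Nat.sqrt X / (e * r.natAbs) + 1 := by
  have hinj : Set.InjOn (Prod.swap : ℤ × ℤ → ℤ × ℤ) F := fun _ _ _ _ h => Prod.swap_inj.mp h
  rw [← card_image_of_injOn hinj]
  refine card_le_of_line (X := X) (r := s) (s := r) (k := k) (e := e) ?_ hr hrs.symm ?_ he her ?_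
  · intro uv huv
    obtain ⟨w, hw, rfl⟩ := mem_image.mp huv
    simpa [add_comm] using hF w hw
  · intro uv huv
    obtain ⟨w, hw, rfl⟩ := mem_image.mp huv
    simp only [Prod.fst_swap, Prod.snd_swap]
    linear_combination hline w hw
  · intro uv huv uv' huv'
    obtain ⟨w, hw, rfl⟩ := mem_image.mp huv
    obtain ⟨w', hw', rfl⟩ := mem_image.mp huv'
    simpa using hmod w hw w' hw'

/-- **Points of a line in a disc**: for `(r, s) = 1`, not both zero, the lattice points of
`u² + v² ≤ X` on the line `u r + v s = k` number at most `2⌊√X⌋/max(|r|, |s|) + 1`.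
[cite: FriedlanderIwaniecAnnals1998, §5, proofs of (5.10) and (5.16)] -/
theorem card_filter_line_le {S : Finset (ℤ × ℤ)} {X : ℕ}
    (hS : ∀ uv ∈ S, uv.1 ^ 2 + uv.2 ^ 2 ≤ (X : ℤ))
    {r s : ℤ} (hrs : IsCoprime r s) (h0 : r ≠ 0 ∨ s ≠ 0) (k : ℤ) :
    #(S.filter fun uv => uv.1 * r + uv.2 * s = k) ≤
      2 * Nat.sqrt X / max r.natAbs s.natAbs + 1 := by
  set F := S.filter fun uv => uv.1 * r + uv.2 * s = k with hFdef
  have hF : ∀ uv ∈ F, uv.1 ^ 2 + uv.2 ^ 2 ≤ (X : ℤ) := fun uv huv => hS uv (mem_filter.mp huv).1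
  have hline : ∀ uv ∈ F, uv.1 * r + uv.2 * s = k := fun uv huv => (mem_filter.mp huv).2
  have hone : ∀ uv ∈ F, ∀ uv' ∈ F, ((1 : ℕ) : ℤ) ∣ uv.1 - uv'.1 := fun _ _ _ _ => by simp
  have hone' : ∀ uv ∈ F, ∀ uv' ∈ F, ((1 : ℕ) : ℤ) ∣ uv.2 - uv'.2 := fun _ _ _ _ => by simp
  rcases le_total r.natAbs s.natAbs with hle | hle
  · rw [max_eq_right hle]
    have hs : s ≠ 0 := by
      rintro rfl
      simp only [Int.natAbs_zero, nonpos_iff_eq_zero, Int.natAbs_eq_zero] at hle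
      tauto
    have := card_le_of_line hF hs hrs hline Nat.one_pos (isCoprime_one_left) hone
    simpa using this
  · rw [max_eq_left hle]
    have hr : r ≠ 0 := by
      rintro rfl
      simp only [Int.natAbs_zero, nonpos_iff_eq_zero, Int.natAbs_eq_zero] at hle
      tauto
    have := card_le_of_line' hF hr hrs hline Nat.one_pos (isCoprime_one_left) hone'
    simpa using this

/-! ### `Σ_w 𝔷(u r + v s)` as a count of pairs `(w, c)` -/

/-- `𝔷(b)` counted in any symmetric range containing the square roots of `b`. [folklore] -/
theorem fiZeta_eq_card_Icc {b : ℤ} {T : ℕ} (hT : ∀ c : ℤ, c ^ 2 = b → c.natAbs ≤ T) :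
    fiZeta b = #((Icc (-(T : ℤ)) T).filter fun c => c ^ 2 = b) := by
  unfold fiZeta
  congr 1
  ext c
  simp only [mem_filter, mem_Icc]
  constructor
  · rintro ⟨-, hc⟩
    have := hT c hc
    refine ⟨⟨?_, ?_⟩, hc⟩ <;> omega
  · rintro ⟨-, hc⟩
    exact ⟨mem_Icc.mp (mem_Icc_natAbs_of_sq_eq hc), hc⟩

/-- Cauchy–Schwarz for the square roots: `c² = u r + v s`, `u² + v² ≤ X`, `r² + s² = n` force
`|c| ≤ (X n)^{1/4}` ("Put `ur + vs = c²` with `|c| ≤ 2(MN)^{1/4}`"). [cite: FriedlanderIwaniecAnnals1998, §5, proof of (5.10)] -/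
theorem natAbs_le_of_sq_eq_line {u v r s c : ℤ} {X n : ℕ} (huv : u ^ 2 + v ^ 2 ≤ (X : ℤ))
    (hrs : r ^ 2 + s ^ 2 = (n : ℤ)) (hc : c ^ 2 = u * r + v * s) :
    c.natAbs ≤ Nat.sqrt (Nat.sqrt (X * n)) := by
  have hcs : (u * r + v * s) ^ 2 ≤ (u ^ 2 + v ^ 2) * (r ^ 2 + s ^ 2) := by
    nlinarith [sq_nonneg (u * s - v * r)]
  have hn0 : (0 : ℤ) ≤ r ^ 2 + s ^ 2 := by positivity
  have h4 : c ^ 4 ≤ ((X * n : ℕ) : ℤ) := by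
    calc c ^ 4 = (u * r + v * s) ^ 2 := by rw [← hc]; ring
      _ ≤ (u ^ 2 + v ^ 2) * (r ^ 2 + s ^ 2) := hcs
      _ ≤ (X : ℤ) * (r ^ 2 + s ^ 2) := mul_le_mul_of_nonneg_right huv hn0
      _ = ((X * n : ℕ) : ℤ) := by rw [hrs]; push_cast; ring
  have := mem_Icc.mp (mem_Icc_sqrt_sqrt_of_pow_four_le h4)
  omega

/-- `Σ_{w ∈ S} 𝔷(u r + v s) = Σ_{|c| ≤ T} #{w ∈ S : u r + v s = c²}` whenever `T` bounds the square
roots that occur (double counting of the pairs `(w, c)`). [folklore] -/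
theorem sum_fiZeta_eq_sum_card (S : Finset (ℤ × ℤ)) (r s : ℤ) {T : ℕ}
    (hT : ∀ uv ∈ S, ∀ c : ℤ, c ^ 2 = uv.1 * r + uv.2 * s → c.natAbs ≤ T) :
    ∑ uv ∈ S, fiZeta (uv.1 * r + uv.2 * s) =
      ∑ c ∈ Icc (-(T : ℤ)) T, #(S.filter fun uv => uv.1 * r + uv.2 * s = c ^ 2) := by
  calc ∑ uv ∈ S, fiZeta (uv.1 * r + uv.2 * s)
      = ∑ uv ∈ S, #((Icc (-(T : ℤ)) T).filter fun c => c ^ 2 = uv.1 * r + uv.2 * s) :=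
        sum_congr rfl fun uv huv => fiZeta_eq_card_Icc (hT uv huv)
    _ = ∑ uv ∈ S, ∑ c ∈ Icc (-(T : ℤ)) T, if c ^ 2 = uv.1 * r + uv.2 * s then 1 else 0 := by
        simp_rw [card_filter]
    _ = ∑ c ∈ Icc (-(T : ℤ)) T, ∑ uv ∈ S, if uv.1 * r + uv.2 * s = c ^ 2 then 1 else 0 := by
        rw [sum_comm]
        refine sum_congr rfl fun c _ => sum_congr rfl fun uv _ => ?_
        simp_rw [eq_comm]
    _ = _ := by simp_rw [card_filter]

/-- **`Σ_{w} 𝔷(Re w̄ z)` over a disc, for primitive `z`**: if `S ⊆ {u² + v² ≤ X}`, `r² + s² = n ≥ 1`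
and `(r, s) = 1`, then `Σ_{(u,v) ∈ S} 𝔷(u r + v s) ≤ (2⌊(Xn)^{1/4}⌋ + 1)(2⌊√X⌋/max(|r|,|s|) + 1)`
(the number of admissible `c`, times the points of `S` on each line `u r + v s = c²`).
[cite: FriedlanderIwaniecAnnals1998, §5, "`ℬ(M,N) ≪ Σ_{M<u²+v²≤2M} Σ_{ur+vs=□} |β| ≪ M^{3/4}N^{-1/4} Σ |β|`"] -/
theorem sum_fiZeta_line_le {S : Finset (ℤ × ℤ)} {X : ℕ}
    (hS : ∀ uv ∈ S, uv.1 ^ 2 + uv.2 ^ 2 ≤ (X : ℤ))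
    {r s : ℤ} {n : ℕ} (hrs : r ^ 2 + s ^ 2 = (n : ℤ)) (hcop : IsCoprime r s) (hn : 0 < n) :
    ∑ uv ∈ S, fiZeta (uv.1 * r + uv.2 * s) ≤
      (2 * Nat.sqrt (Nat.sqrt (X * n)) + 1) * (2 * Nat.sqrt X / max r.natAbs s.natAbs + 1) := by
  have h0 : r ≠ 0 ∨ s ≠ 0 := by
    by_contra h
    push Not at h
    obtain ⟨rfl, rfl⟩ := h
    simp at hrs
    omega
  rw [sum_fiZeta_eq_sum_card S r s (T := Nat.sqrt (Nat.sqrt (X * n)))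
    (fun uv huv c hc => natAbs_le_of_sq_eq_line (hS uv huv) hrs hc)]
  calc ∑ c ∈ Icc (-(Nat.sqrt (Nat.sqrt (X * n)) : ℤ)) (Nat.sqrt (Nat.sqrt (X * n))),
        #(S.filter fun uv => uv.1 * r + uv.2 * s = c ^ 2)
      ≤ ∑ c ∈ Icc (-(Nat.sqrt (Nat.sqrt (X * n)) : ℤ)) (Nat.sqrt (Nat.sqrt (X * n))),
          (2 * Nat.sqrt X / max r.natAbs s.natAbs + 1) :=
        sum_le_sum fun c _ => card_filter_line_le hS hcop h0 (c ^ 2)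
    _ = _ := by
        rw [sum_const, smul_eq_mul, Int.card_Icc]
        congr 1
        omega

/-! ### The complementary form of (5.10): lines with a congruence modulo `p` -/

/-- A prime dividing `r² + s²` with `(r, s) = 1` divides neither `r` nor `s`
("Note that `p ∤ rs`"). [cite: FriedlanderIwaniecAnnals1998, §5, proof of (5.10)] -/
theorem not_dvd_of_prime_dvd_sq_add_sq {p r s : ℤ} (hp : Prime p) (hrs : IsCoprime r s)
    (hprs : p ∣ r ^ 2 + s ^ 2) : ¬ p ∣ r ∧ ¬ p ∣ s := by
  have key : ∀ {a b : ℤ}, IsCoprime a b → p ∣ a ^ 2 + b ^ 2 → ¬ p ∣ a := by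
    intro a b hab hp2 hpa
    have ha2 : p ∣ a ^ 2 := dvd_pow hpa two_ne_zero
    have hb2 : p ∣ b ^ 2 := (dvd_add_right ha2).mp hp2
    have hpb : p ∣ b := hp.dvd_of_dvd_pow hb2
    exact hp.not_unit (hab.isUnit_of_dvd' hpa hpb)
  exact ⟨key hrs hprs, key hrs.symm (by rwa [add_comm])⟩

/-- **The congruence behind (5.10).** On the line `u r + v s = c²` with `p ∣ r² + s²`, `(r, s) = 1`,
`p` prime, `p ∤ 2c`: any two points with `p ∣ u² + v²` have `u ≡ u' (mod p)` (from
`s²(u² + v²) = (r² + s²)u² - 2c²ru + c⁴`, so `2ru ≡ c² (mod p)`, and `p ∤ 2r`) — "Given `c, r, s`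
the residue class of `u (mod ps/(c, p))` is fixed". [cite: FriedlanderIwaniecAnnals1998, §5, proof of (5.10)] -/
theorem dvd_sub_of_line_of_dvd_norm {p r s c u v u' v' : ℤ} (hp : Prime p) (hp2 : ¬ p ∣ 2)
    (hrs : IsCoprime r s) (hprs : p ∣ r ^ 2 + s ^ 2) (hc : ¬ p ∣ c)
    (h1 : u * r + v * s = c ^ 2) (h1p : p ∣ u ^ 2 + v ^ 2)
    (h2 : u' * r + v' * s = c ^ 2) (h2p : p ∣ u' ^ 2 + v' ^ 2) :
    p ∣ u - u' := by
  have hpr : ¬ p ∣ r := (not_dvd_of_prime_dvd_sq_add_sq hp hrs hprs).1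
  -- `p ∣ c² (c² - 2 r u)` for every such point
  have key : ∀ {a b : ℤ}, a * r + b * s = c ^ 2 → p ∣ a ^ 2 + b ^ 2 → p ∣ c ^ 2 - 2 * r * a := by
    intro a b hab hpab
    have e : c ^ 2 * (c ^ 2 - 2 * r * a) = s ^ 2 * (a ^ 2 + b ^ 2) - (r ^ 2 + s ^ 2) * a ^ 2 := by
      have hb : b * s = c ^ 2 - a * r := by linear_combination hab
      linear_combination (-(b * s + c ^ 2 - a * r)) * hb
    have hd : p ∣ c ^ 2 * (c ^ 2 - 2 * r * a) := by
      rw [e]; exact dvd_sub (dvd_mul_of_dvd_right hpab _) (dvd_mul_of_dvd_left hprs _)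
    rcases hp.dvd_or_dvd hd with h | h
    · exact absurd (hp.dvd_of_dvd_pow h) hc
    · exact h
  have d1 := key h1 h1p
  have d2 := key h2 h2p
  have d3 : p ∣ 2 * (r * (u' - u)) := by
    have := dvd_sub d1 d2
    have e : c ^ 2 - 2 * r * u - (c ^ 2 - 2 * r * u') = 2 * (r * (u' - u)) := by ring
    rwa [e] at this
  rcases hp.dvd_or_dvd d3 with h | h
  · exact absurd h hp2
  rcases hp.dvd_or_dvd h with h | h
  · exact absurd h hpr
  · have : p ∣ -(u' - u) := dvd_neg.mpr h
    rwa [neg_sub] at this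

/-- `#{c ∈ [-T, T] : p ∣ c} ≤ 2T/p + 1`. [folklore] -/
theorem card_Icc_filter_dvd_le {p : ℕ} (hp : 0 < p) (T : ℕ) :
    #((Icc (-(T : ℤ)) T).filter fun c => (p : ℤ) ∣ c) ≤ 2 * T / p + 1 := by
  have h := card_Icc_filter_dvd_sub_le' hp (-(T : ℤ)) T 0
  simp only [sub_zero] at h
  refine h.trans_eq ?_
  congr 2
  rw [show (T : ℤ) - -(T : ℤ) = ((2 * T : ℕ) : ℤ) by push_cast; ring, Int.toNat_natCast]

/-- **The count behind (5.10)**: for primitive `z = r + is` of norm `n ≥ 1`, an odd prime `p ∣ n`,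
and `S ⊆ {u² + v² ≤ X}`:
`Σ_{(u,v) ∈ S, p ∣ u²+v²} 𝔷(u r + v s) ≤ (2T + 1)(2⌊√X⌋/(p q) + 1) + (2T/p + 1)(2⌊√X⌋/q + 1)`,
`T = ⌊(Xn)^{1/4}⌋`, `q = max(|r|, |s|)`: for the `c` prime to `p` the points lie in one class modulo
`pq` (`dvd_sub_of_line_of_dvd_norm`), for the `≤ 2T/p + 1` multiples of `p` only in one class
modulo `q` ("the number of points `w = u + iv` is bounded by `O(1 + √M (c, p)/ps)` … Summing over `c`").
[cite: FriedlanderIwaniecAnnals1998, §5, proof of (5.10)] -/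
theorem sum_fiZeta_line_dvd_le {S : Finset (ℤ × ℤ)} {X : ℕ}
    (hS : ∀ uv ∈ S, uv.1 ^ 2 + uv.2 ^ 2 ≤ (X : ℤ))
    {r s : ℤ} {n : ℕ} (hrs : r ^ 2 + s ^ 2 = (n : ℤ)) (hcop : IsCoprime r s) (hn : 0 < n)
    {p : ℕ} (hp : p.Prime) (hp2 : p ≠ 2) (hpn : p ∣ n) :
    ∑ uv ∈ S.filter (fun uv => (p : ℤ) ∣ uv.1 ^ 2 + uv.2 ^ 2), fiZeta (uv.1 * r + uv.2 * s) ≤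
      (2 * Nat.sqrt (Nat.sqrt (X * n)) + 1) * (2 * Nat.sqrt X / (p * max r.natAbs s.natAbs) + 1) +
        (2 * Nat.sqrt (Nat.sqrt (X * n)) / p + 1) * (2 * Nat.sqrt X / max r.natAbs s.natAbs + 1) := by
  set T := Nat.sqrt (Nat.sqrt (X * n)) with hT
  set q := max r.natAbs s.natAbs with hq
  set S' := S.filter (fun uv => (p : ℤ) ∣ uv.1 ^ 2 + uv.2 ^ 2) with hS'
  have hS'S : ∀ uv ∈ S', uv.1 ^ 2 + uv.2 ^ 2 ≤ (X : ℤ) := fun uv huv => hS uv (mem_filter.mp huv).1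
  have hpz : Prime (p : ℤ) := Nat.prime_iff_prime_int.mp hp
  have hp0 : 0 < p := hp.pos
  have hp2' : ¬ (p : ℤ) ∣ 2 := by
    intro h
    have : (p : ℤ) ≤ 2 := Int.le_of_dvd (by norm_num) h
    have h2 := hp.two_le
    have : p = 2 := by omega
    exact hp2 this
  have hprs : (p : ℤ) ∣ r ^ 2 + s ^ 2 := by rw [hrs]; exact Int.natCast_dvd_natCast.mpr hpn
  obtain ⟨hpr, hps⟩ := not_dvd_of_prime_dvd_sq_add_sq hpz hcop hprs
  have h0 : r ≠ 0 ∨ s ≠ 0 := by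
    by_contra h
    push Not at h
    obtain ⟨rfl, rfl⟩ := h
    simp at hrs
    omega
  rw [sum_fiZeta_eq_sum_card S' r s (T := T)
    (fun uv huv c hc => natAbs_le_of_sq_eq_line (hS'S uv huv) hrs hc)]
  -- the two kinds of `c`
  have hgood : ∀ c : ℤ, ¬ (p : ℤ) ∣ c →
      #(S'.filter fun uv => uv.1 * r + uv.2 * s = c ^ 2) ≤ 2 * Nat.sqrt X / (p * q) + 1 := by
    intro c hc
    set F := S'.filter fun uv => uv.1 * r + uv.2 * s = c ^ 2 with hF
    have hF1 : ∀ uv ∈ F, uv.1 ^ 2 + uv.2 ^ 2 ≤ (X : ℤ) := fun uv huv => hS'S uv (mem_filter.mp huv).1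
    have hF2 : ∀ uv ∈ F, uv.1 * r + uv.2 * s = c ^ 2 := fun uv huv => (mem_filter.mp huv).2
    have hF3 : ∀ uv ∈ F, (p : ℤ) ∣ uv.1 ^ 2 + uv.2 ^ 2 := fun uv huv =>
      (mem_filter.mp (mem_filter.mp huv).1).2
    rcases le_total r.natAbs s.natAbs with hle | hle
    · rw [hq, max_eq_right hle]
      have hs : s ≠ 0 := by
        rintro rfl
        simp only [Int.natAbs_zero, nonpos_iff_eq_zero, Int.natAbs_eq_zero] at hle
        tauto
      refine card_le_of_line hF1 hs hcop hF2 hp0 ((Prime.coprime_iff_not_dvd hpz).mpr hps) ?_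
      intro uv huv uv' huv'
      exact dvd_sub_of_line_of_dvd_norm hpz hp2' hcop hprs hc (hF2 uv huv) (hF3 uv huv)
        (hF2 uv' huv') (hF3 uv' huv')
    · rw [hq, max_eq_left hle]
      have hr : r ≠ 0 := by
        rintro rfl
        simp only [Int.natAbs_zero, nonpos_iff_eq_zero, Int.natAbs_eq_zero] at hle
        tauto
      refine card_le_of_line' hF1 hr hcop hF2 hp0 ((Prime.coprime_iff_not_dvd hpz).mpr hpr) ?_
      intro uv huv uv' huv'
      have hprs' : (p : ℤ) ∣ s ^ 2 + r ^ 2 := by rwa [add_comm]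
      refine dvd_sub_of_line_of_dvd_norm hpz hp2' hcop.symm hprs' hc (u := uv.2) (v := uv.1)
        (u' := uv'.2) (v' := uv'.1) ?_ ?_ ?_ ?_
      · linear_combination hF2 uv huv
      · rw [add_comm]; exact hF3 uv huv
      · linear_combination hF2 uv' huv'
      · rw [add_comm]; exact hF3 uv' huv'
  have hbad : ∀ c : ℤ, #(S'.filter fun uv => uv.1 * r + uv.2 * s = c ^ 2) ≤ 2 * Nat.sqrt X / q + 1 :=
    fun c => card_filter_line_le hS'S hcop h0 (c ^ 2)
  rw [← sum_filter_add_sum_filter_not (Icc (-(T : ℤ)) T) (fun c => (p : ℤ) ∣ c), add_comm]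
  refine Nat.add_le_add ?_ ?_
  · calc ∑ c ∈ (Icc (-(T : ℤ)) T).filter (fun c => ¬ (p : ℤ) ∣ c),
          #(S'.filter fun uv => uv.1 * r + uv.2 * s = c ^ 2)
        ≤ ∑ c ∈ (Icc (-(T : ℤ)) T).filter (fun c => ¬ (p : ℤ) ∣ c), (2 * Nat.sqrt X / (p * q) + 1) :=
          sum_le_sum fun c hc => hgood c (mem_filter.mp hc).2
      _ ≤ ∑ c ∈ Icc (-(T : ℤ)) T, (2 * Nat.sqrt X / (p * q) + 1) :=
          sum_le_sum_of_subset_of_nonneg (filter_subset _ _) fun _ _ _ => Nat.zero_le _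
      _ = (2 * T + 1) * (2 * Nat.sqrt X / (p * q) + 1) := by
          rw [sum_const, smul_eq_mul, Int.card_Icc]; congr 1; omega
  · calc ∑ c ∈ (Icc (-(T : ℤ)) T).filter (fun c => (p : ℤ) ∣ c),
          #(S'.filter fun uv => uv.1 * r + uv.2 * s = c ^ 2)
        ≤ ∑ c ∈ (Icc (-(T : ℤ)) T).filter (fun c => (p : ℤ) ∣ c), (2 * Nat.sqrt X / q + 1) :=
          sum_le_sum fun c _ => hbad c
      _ = #((Icc (-(T : ℤ)) T).filter fun c => (p : ℤ) ∣ c) * (2 * Nat.sqrt X / q + 1) := by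
          rw [sum_const, smul_eq_mul]
      _ ≤ (2 * T / p + 1) * (2 * Nat.sqrt X / q + 1) :=
          Nat.mul_le_mul_right _ (card_Icc_filter_dvd_le hp0 T)

/-! ### Square-congruences in a run of integers (general constant term) -/

/-- For fixed `t`: `#{a ∈ [lo, hi] : d ∣ a² + t} ≤ ((hi - lo)/d + 1) N(d, -t)` (fibre over `a mod d`;
the tree's `card_Icc_filter_dvd_sq_add_le'` is the case `t = c⁴`). [folklore] -/
theorem card_Icc_filter_dvd_sq_add_le'' {d : ℕ} (hd : 0 < d) (lo hi : ℤ) (t : ℤ) :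
    #{a ∈ Icc lo hi | (d : ℤ) ∣ a ^ 2 + t} ≤
      ((hi - lo).toNat / d + 1) * sqCongrCount d (-t) := by
  set s := {a ∈ Icc lo hi | (d : ℤ) ∣ a ^ 2 + t} with hs
  set f : ℤ → ℕ := fun a => (a % (d : ℤ)).toNat with hf_def
  have hdz : (0 : ℤ) < d := by exact_mod_cast hd
  have hf : ∀ a, ((f a : ℕ) : ℤ) = a % (d : ℤ) := fun a =>
    Int.toNat_of_nonneg (Int.emod_nonneg _ hdz.ne')
  have h1 : #s ≤ ((hi - lo).toNat / d + 1) * #(s.image f) := by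
    refine card_le_mul_card_image s _ fun ν _ => ?_
    calc #(s.filter fun a => f a = ν) ≤ #{a ∈ Icc lo hi | (d : ℤ) ∣ a - (ν : ℤ)} := by
          refine card_le_card fun a ha => ?_
          obtain ⟨has, hfa⟩ := mem_filter.mp ha
          refine mem_filter.mpr ⟨(mem_filter.mp has).1, ?_⟩
          rw [← hfa, hf a, Int.emod_def]
          exact ⟨a / d, by ring⟩
      _ ≤ (hi - lo).toNat / d + 1 := card_Icc_filter_dvd_sub_le' hd lo hi ν
  have h2 : s.image f ⊆ (range d).filter fun ν : ℕ => (d : ℤ) ∣ (ν : ℤ) ^ 2 - -t := by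
    intro ν hν
    obtain ⟨a, ha, rfl⟩ := mem_image.mp hν
    obtain ⟨-, hdvd⟩ := mem_filter.mp ha
    refine mem_filter.mpr ⟨mem_range.mpr ?_, ?_⟩
    · have : ((f a : ℕ) : ℤ) < d := by rw [hf]; exact Int.emod_lt_of_pos _ hdz
      exact_mod_cast this
    · rw [hf a]
      have e : (a % (d : ℤ)) ^ 2 - -t =
          (a ^ 2 + t) - (d : ℤ) * ((a / d) * (2 * a - d * (a / d))) := by
        rw [Int.emod_def]; ring
      rw [e]
      exact hdvd.sub (dvd_mul_right _ _)
  calc #s ≤ ((hi - lo).toNat / d + 1) * #(s.image f) := h1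
    _ ≤ ((hi - lo).toNat / d + 1) * sqCongrCount d (-t) :=
        Nat.mul_le_mul_left _ (card_le_card h2)

/-! ### Lattice points of a thin annulus near the axes, in residue classes -/

/-- The integer part of `√(Y - s²)` (`0` if `s² > Y`): the largest `a ≥ 0` with `a² + s² ≤ Y`.
[folklore] -/
def circRadius (Y : ℕ) (s : ℤ) : ℕ := Nat.sqrt ((Y : ℤ) - s ^ 2).toNat

/-- `circRadius` is monotone in `Y`. [folklore] -/
theorem circRadius_mono {Y₁ Y₂ : ℕ} (h : Y₁ ≤ Y₂) (s : ℤ) : circRadius Y₁ s ≤ circRadius Y₂ s := by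
  unfold circRadius
  apply Nat.sqrt_le_sqrt
  apply Int.toNat_le_toNat
  have : (Y₁ : ℤ) ≤ Y₂ := by exact_mod_cast h
  linarith

/-- `a² + s² ≤ Y` gives `a ≤ circRadius Y s`. [folklore] -/
theorem le_circRadius_of_sq_add_le {Y : ℕ} {a s : ℤ} (h : a ^ 2 + s ^ 2 ≤ (Y : ℤ)) :
    a ≤ circRadius Y s := by
  unfold circRadius
  set M := ((Y : ℤ) - s ^ 2).toNat with hM
  have hMz : (M : ℤ) = Y - s ^ 2 := Int.toNat_of_nonneg (by nlinarith [sq_nonneg a])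
  have : a ^ 2 ≤ (M : ℤ) := by rw [hMz]; linarith
  exact (mem_Icc.mp (mem_Icc_sqrt_of_sq_le this)).2

/-- A positive `a` with `a² + s² > Y` has `circRadius Y s < a`. [folklore] -/
theorem circRadius_lt_of_lt_sq_add {Y : ℕ} {a s : ℤ} (ha : 0 < a) (h : (Y : ℤ) < a ^ 2 + s ^ 2) :
    (circRadius Y s : ℤ) < a := by
  unfold circRadius
  set M := ((Y : ℤ) - s ^ 2).toNat with hM
  by_contra hle
  rw [not_lt] at hle
  have hs : ((Nat.sqrt M) ^ 2 : ℕ) ≤ M := Nat.sqrt_le' M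
  have hs' : (Nat.sqrt M : ℤ) ^ 2 ≤ M := by exact_mod_cast hs
  have ha2 : a ^ 2 ≤ (M : ℤ) := by nlinarith
  rcases le_or_gt (s ^ 2) (Y : ℤ) with hcY | hcY
  · have hMz : (M : ℤ) = Y - s ^ 2 := Int.toNat_of_nonneg (by linarith)
    rw [hMz] at ha2
    linarith
  · have hM0 : M = 0 := by rw [hM]; exact Int.toNat_of_nonpos (by linarith)
    rw [hM0] at ha2
    push_cast at ha2
    nlinarith

/-- The fibre over `s` of the annulus count, for squarefree `d ≥ 1`:
`#{a ∈ [-Y₂, Y₂] : Y₁ < a² + s² ≤ Y₂, d ∣ a² + s²} ≤ τ(d) (2((c₂ - c₁)/d + 1) + 1)` with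
`cᵢ = circRadius Yᵢ s` (positive `a` lie in `(c₁, c₂]`, negative ones in the mirror image, `a = 0`
is one more point; `N(d, -s²) ≤ τ(d)`). [folklore] -/
theorem card_circFibre_le {d : ℕ} (hd : 0 < d) (hsq : Squarefree d) {Y₁ Y₂ : ℕ} (hY : Y₁ ≤ Y₂)
    (s : ℤ) :
    #{a ∈ Icc (-(Y₂ : ℤ)) Y₂ | (Y₁ : ℤ) < a ^ 2 + s ^ 2 ∧ a ^ 2 + s ^ 2 ≤ (Y₂ : ℤ) ∧
        (d : ℤ) ∣ a ^ 2 + s ^ 2} ≤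
      #d.divisors * (2 * ((circRadius Y₂ s - circRadius Y₁ s) / d + 1) + 1) := by
  set r₁ := circRadius Y₁ s with hr₁
  set r₂ := circRadius Y₂ s with hr₂
  set F := {a ∈ Icc (-(Y₂ : ℤ)) Y₂ | (Y₁ : ℤ) < a ^ 2 + s ^ 2 ∧ a ^ 2 + s ^ 2 ≤ (Y₂ : ℤ) ∧
        (d : ℤ) ∣ a ^ 2 + s ^ 2} with hF
  set Fp := {a ∈ Icc ((r₁ : ℤ) + 1) r₂ | (d : ℤ) ∣ a ^ 2 + s ^ 2} with hFp
  have hpos : ∀ a ∈ F, 0 < a → a ∈ Fp := by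
    intro a ha ha0
    obtain ⟨-, h1, h2, h3⟩ := mem_filter.mp ha
    refine mem_filter.mpr ⟨mem_Icc.mpr ⟨?_, le_circRadius_of_sq_add_le h2⟩, h3⟩
    have := circRadius_lt_of_lt_sq_add ha0 h1
    omega
  have hneg : ∀ a ∈ F, a < 0 → a ∈ Fp.image Neg.neg := by
    intro a ha ha0
    obtain ⟨-, h1, h2, h3⟩ := mem_filter.mp ha
    refine mem_image.mpr ⟨-a, ?_, neg_neg a⟩
    have e : (-a) ^ 2 + s ^ 2 = a ^ 2 + s ^ 2 := by ring
    refine mem_filter.mpr ⟨mem_Icc.mpr ⟨?_, ?_⟩, ?_⟩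
    · have := circRadius_lt_of_lt_sq_add (a := -a) (by omega) (by rw [e]; exact h1)
      omega
    · exact le_circRadius_of_sq_add_le (by rw [e]; exact h2)
    · rw [e]; exact h3
  have hsub : F ⊆ Fp ∪ Fp.image Neg.neg ∪ {0} := by
    intro a ha
    rcases lt_trichotomy a 0 with h | h | h
    · exact mem_union_left _ (mem_union_right _ (hneg a ha h))
    · simp [h]
    · exact mem_union_left _ (mem_union_left _ (hpos a ha h))
  have hFp : #Fp ≤ ((r₂ - r₁) / d + 1) * #d.divisors := by
    calc #Fp ≤ (((r₂ : ℤ) - ((r₁ : ℤ) + 1)).toNat / d + 1) * sqCongrCount d (-s ^ 2) :=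
          card_Icc_filter_dvd_sq_add_le'' hd _ _ (s ^ 2)
      _ ≤ ((r₂ - r₁) / d + 1) * #d.divisors := by
          apply Nat.mul_le_mul
          · apply Nat.add_le_add_right
            apply Nat.div_le_div_right
            have : ((r₂ : ℤ) - ((r₁ : ℤ) + 1)).toNat ≤ ((r₂ : ℤ) - (r₁ : ℤ)).toNat :=
              Int.toNat_le_toNat (by linarith)
            refine this.trans ?_
            rw [show ((r₂ : ℤ) - (r₁ : ℤ)) = ((r₂ - r₁ : ℕ) : ℤ) from ?_, Int.toNat_natCast]
            have : r₁ ≤ r₂ := circRadius_mono hY s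
            push_cast [this]; ring
          · exact sqCongrCount_le_card_divisors_of_squarefree _ d hsq
  have h1 : 1 ≤ #d.divisors := one_le_card_divisors hd.ne'
  calc #F ≤ #(Fp ∪ Fp.image Neg.neg ∪ {0}) := card_le_card hsub
    _ ≤ #(Fp ∪ Fp.image Neg.neg) + #({0} : Finset ℤ) := card_union_le _ _
    _ ≤ #Fp + #(Fp.image Neg.neg) + 1 := by
        rw [card_singleton]; exact Nat.add_le_add_right (card_union_le _ _) 1
    _ ≤ #Fp + #Fp + 1 := Nat.add_le_add_right (Nat.add_le_add_left Finset.card_image_le _) 1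
    _ ≤ ((r₂ - r₁) / d + 1) * #d.divisors + ((r₂ - r₁) / d + 1) * #d.divisors + #d.divisors := by
        gcongr
    _ = #d.divisors * (2 * ((r₂ - r₁) / d + 1) + 1) := by ring

/-- The radial thickness of the annulus along the fibre `s`: for `2s² ≤ Y₁ ≤ Y₂`, `Y₁ ≥ 1`,
`circRadius Y₂ s - circRadius Y₁ s ≤ (Y₂ - Y₁)/√(2Y₁) + 1`
(`√(Y₂ - s²) - √(Y₁ - s²) = (Y₂ - Y₁)/(√(Y₂ - s²) + √(Y₁ - s²)) ≤ (Y₂ - Y₁)/(2√(Y₁/2))`). [folklore] -/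
theorem circRadius_sub_le {Y₁ Y₂ : ℕ} (hY : Y₁ ≤ Y₂) (hY₁ : 0 < Y₁) {s : ℤ} (hs : 2 * s ^ 2 ≤ (Y₁ : ℤ)) :
    (circRadius Y₂ s : ℝ) - circRadius Y₁ s ≤ ((Y₂ : ℝ) - Y₁) / Real.sqrt (2 * Y₁) + 1 := by
  set A := ((Y₂ : ℤ) - s ^ 2).toNat with hA
  set B := ((Y₁ : ℤ) - s ^ 2).toNat with hB
  have hs2 : 0 ≤ s ^ 2 := sq_nonneg s
  have hY' : (Y₁ : ℤ) ≤ Y₂ := by exact_mod_cast hY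
  have hAz : (A : ℤ) = Y₂ - s ^ 2 := Int.toNat_of_nonneg (by linarith)
  have hBz : (B : ℤ) = Y₁ - s ^ 2 := Int.toNat_of_nonneg (by linarith)
  have hAr : (A : ℝ) = (Y₂ : ℝ) - (s : ℝ) ^ 2 := by exact_mod_cast hAz
  have hBr : (B : ℝ) = (Y₁ : ℝ) - (s : ℝ) ^ 2 := by exact_mod_cast hBz
  have hsr : 2 * (s : ℝ) ^ 2 ≤ (Y₁ : ℝ) := by exact_mod_cast hs
  have hY₁r : (0 : ℝ) < Y₁ := by exact_mod_cast hY₁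
  have hYr : (Y₁ : ℝ) ≤ Y₂ := by exact_mod_cast hY
  have hBpos : (Y₁ : ℝ) / 2 ≤ B := by rw [hBr]; linarith
  have hB0 : (0 : ℝ) < B := by linarith
  have hAB : (B : ℝ) ≤ A := by rw [hAr, hBr]; linarith
  -- `c₂ ≤ √A`, `c₁ > √B - 1`
  have h2 : (circRadius Y₂ s : ℝ) ≤ Real.sqrt A := Real.nat_sqrt_le_real_sqrt
  have h1 : Real.sqrt B < (circRadius Y₁ s : ℝ) + 1 := Real.real_sqrt_lt_nat_sqrt_succ
  -- `√A - √B ≤ (A - B)/(2√B)` and `2√B ≥ √(2Y₁)`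
  have hsB : 0 < Real.sqrt B := Real.sqrt_pos.mpr hB0
  have hsA : Real.sqrt B ≤ Real.sqrt A := Real.sqrt_le_sqrt hAB
  have hdiff : Real.sqrt A - Real.sqrt B ≤ ((A : ℝ) - B) / (2 * Real.sqrt B) := by
    rw [le_div_iff₀ (by positivity)]
    have eA : Real.sqrt A * Real.sqrt A = A := Real.mul_self_sqrt (by positivity)
    have eB : Real.sqrt B * Real.sqrt B = B := Real.mul_self_sqrt (by positivity)
    nlinarith
  have hden : Real.sqrt (2 * Y₁) ≤ 2 * Real.sqrt B := by
    have : Real.sqrt (2 * Y₁) = Real.sqrt 4 * Real.sqrt ((Y₁ : ℝ) / 2) := by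
      rw [← Real.sqrt_mul (by norm_num)]; congr 1; ring
    rw [this, show Real.sqrt 4 = 2 by rw [show (4 : ℝ) = 2 ^ 2 by norm_num, Real.sqrt_sq (by norm_num)]]
    exact mul_le_mul_of_nonneg_left (Real.sqrt_le_sqrt hBpos) (by norm_num)
  have hnum : (A : ℝ) - B = (Y₂ : ℝ) - Y₁ := by rw [hAr, hBr]; ring
  have hnum0 : 0 ≤ (Y₂ : ℝ) - Y₁ := by linarith
  have hs2Y : 0 < Real.sqrt (2 * Y₁) := Real.sqrt_pos.mpr (by positivity)
  calc (circRadius Y₂ s : ℝ) - circRadius Y₁ s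
      ≤ Real.sqrt A - (Real.sqrt B - 1) := by linarith
    _ = (Real.sqrt A - Real.sqrt B) + 1 := by ring
    _ ≤ ((A : ℝ) - B) / (2 * Real.sqrt B) + 1 := by linarith
    _ = ((Y₂ : ℝ) - Y₁) / (2 * Real.sqrt B) + 1 := by rw [hnum]
    _ ≤ ((Y₂ : ℝ) - Y₁) / Real.sqrt (2 * Y₁) + 1 := by
        gcongr

/-- The near-axis part of the annulus `Y₁ < r² + s² ≤ Y₂`: lattice points `(r, s)` with
`|r| ≤ W` or `|s| ≤ W`. [cite: FriedlanderIwaniecAnnals1998, §5, "the other sectors, altogether of angle `≤ 2πϑ`"] -/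
def nearAxisSet (W Y₁ Y₂ : ℕ) : Finset (ℤ × ℤ) :=
  ((Icc (-(Y₂ : ℤ)) Y₂) ×ˢ (Icc (-(Y₂ : ℤ)) Y₂)).filter fun z =>
    (z.1.natAbs ≤ W ∨ z.2.natAbs ≤ W) ∧ (Y₁ : ℤ) < z.1 ^ 2 + z.2 ^ 2 ∧ z.1 ^ 2 + z.2 ^ 2 ≤ (Y₂ : ℤ)

/-- The strip `|s| ≤ W` of the annulus, with a divisibility condition. [folklore] -/
def axisStrip (d W Y₁ Y₂ : ℕ) : Finset (ℤ × ℤ) :=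
  ((Icc (-(Y₂ : ℤ)) Y₂) ×ˢ (Icc (-(Y₂ : ℤ)) Y₂)).filter fun z =>
    z.2.natAbs ≤ W ∧ (Y₁ : ℤ) < z.1 ^ 2 + z.2 ^ 2 ∧ z.1 ^ 2 + z.2 ^ 2 ≤ (Y₂ : ℤ) ∧
      (d : ℤ) ∣ z.1 ^ 2 + z.2 ^ 2

/-- The near-axis points with `d ∣ r² + s²` lie in the strip `|s| ≤ W` or in its mirror image
under `(r, s) ↦ (s, r)`, so they number at most twice the strip. [folklore] -/
theorem card_nearAxisSet_filter_le (d W Y₁ Y₂ : ℕ) :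
    #((nearAxisSet W Y₁ Y₂).filter fun z => (d : ℤ) ∣ z.1 ^ 2 + z.2 ^ 2) ≤
      2 * #(axisStrip d W Y₁ Y₂) := by
  set T := (nearAxisSet W Y₁ Y₂).filter fun z => (d : ℤ) ∣ z.1 ^ 2 + z.2 ^ 2 with hT
  -- split by which coordinate is small
  have hsplit : T ⊆ (T.filter fun z => z.2.natAbs ≤ W) ∪ (T.filter fun z => ¬ z.2.natAbs ≤ W) := by
    intro z hz
    by_cases h : z.2.natAbs ≤ W
    · exact mem_union_left _ (mem_filter.mpr ⟨hz, h⟩)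
    · exact mem_union_right _ (mem_filter.mpr ⟨hz, h⟩)
  have hA : T.filter (fun z => z.2.natAbs ≤ W) ⊆ axisStrip d W Y₁ Y₂ := by
    intro z hz
    obtain ⟨hzT, hzW⟩ := mem_filter.mp hz
    obtain ⟨hzN, hzd⟩ := mem_filter.mp hzT
    obtain ⟨hbox, -, h1, h2⟩ := mem_filter.mp hzN
    exact mem_filter.mpr ⟨hbox, hzW, h1, h2, hzd⟩
  have hB : #(T.filter fun z => ¬ z.2.natAbs ≤ W) ≤ #(axisStrip d W Y₁ Y₂) := by
    refine card_le_card_of_injOn Prod.swap ?_ (fun _ _ _ _ h => Prod.swap_inj.mp h)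
    intro z hz
    obtain ⟨hzT, hzW⟩ := mem_filter.mp (mem_coe.mp hz)
    obtain ⟨hzN, hzd⟩ := mem_filter.mp hzT
    obtain ⟨hbox, hor, h1, h2⟩ := mem_filter.mp hzN
    have hr : z.1.natAbs ≤ W := by tauto
    rw [mem_product] at hbox
    refine mem_coe.mpr (mem_filter.mpr ⟨mem_product.mpr ⟨hbox.2, hbox.1⟩, ?_, ?_, ?_, ?_⟩)
    · simpa using hr
    · simp only [Prod.fst_swap, Prod.snd_swap]; linarith
    · simp only [Prod.fst_swap, Prod.snd_swap]; linarith
    · simp only [Prod.fst_swap, Prod.snd_swap]; rwa [add_comm]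
  calc #T ≤ #((T.filter fun z => z.2.natAbs ≤ W) ∪ (T.filter fun z => ¬ z.2.natAbs ≤ W)) :=
        card_le_card hsplit
    _ ≤ #(T.filter fun z => z.2.natAbs ≤ W) + #(T.filter fun z => ¬ z.2.natAbs ≤ W) :=
        card_union_le _ _
    _ ≤ #(axisStrip d W Y₁ Y₂) + #(axisStrip d W Y₁ Y₂) := Nat.add_le_add (card_le_card hA) hB
    _ = 2 * #(axisStrip d W Y₁ Y₂) := by ring

/-- **The strip count**: for squarefree `d ≥ 1`, `1 ≤ Y₁ ≤ Y₂` and `2W² ≤ Y₁`,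
`#{(r, s) : |s| ≤ W, Y₁ < r² + s² ≤ Y₂, d ∣ r² + s²} ≤ (2W + 1) τ(d) (2(Y₂ - Y₁)/(d√(2Y₁)) + 5)`
(fibre over `s`, `card_circFibre_le`, `circRadius_sub_le`).
[cite: FriedlanderIwaniecAnnals1998, §5, "`#{r+is ∈ 𝔅 ; r²+s² ≡ 0 (d)} ≪ θ²Nρ(d)d⁻¹`" (near-axis variant)] -/
theorem card_axisStrip_le {d : ℕ} (hd : 0 < d) (hsq : Squarefree d) {W Y₁ Y₂ : ℕ} (hY : Y₁ ≤ Y₂)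
    (hY₁ : 0 < Y₁) (hW : 2 * W ^ 2 ≤ Y₁) :
    (#(axisStrip d W Y₁ Y₂) : ℝ) ≤
      (2 * W + 1) * #d.divisors * (2 * ((Y₂ : ℝ) - Y₁) / (d * Real.sqrt (2 * Y₁)) + 5) := by
  -- fibre over `s ∈ [-W, W]`
  let g : ℤ → ℕ := fun s => #{a ∈ Icc (-(Y₂ : ℤ)) Y₂ | (Y₁ : ℤ) < a ^ 2 + s ^ 2 ∧
      a ^ 2 + s ^ 2 ≤ (Y₂ : ℤ) ∧ (d : ℤ) ∣ a ^ 2 + s ^ 2}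
  have hslice : #(axisStrip d W Y₁ Y₂) ≤ ∑ s ∈ Icc (-(W : ℤ)) W, g s := by
    have hmaps : ((axisStrip d W Y₁ Y₂ : Finset (ℤ × ℤ)) : Set (ℤ × ℤ)).MapsTo (fun z => z.2)
        ((Icc (-(W : ℤ)) W : Finset ℤ) : Set ℤ) := by
      intro z hz
      obtain ⟨-, hzW, -⟩ := mem_filter.mp (mem_coe.mp hz)
      simp only [mem_coe, mem_Icc]; omega
    rw [card_eq_sum_card_fiberwise hmaps]
    refine sum_le_sum fun s _ => ?_
    simp only [g]
    refine card_le_card_of_injOn (fun z => z.1) ?_ ?_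
    · intro z hz
      obtain ⟨hzA, hzs⟩ := mem_filter.mp (mem_coe.mp hz)
      obtain ⟨hbox, -, h1, h2, h3⟩ := mem_filter.mp hzA
      rw [mem_product] at hbox
      subst hzs
      exact mem_coe.mpr (mem_filter.mpr ⟨hbox.1, h1, h2, h3⟩)
    · intro z hz z' hz' h
      obtain ⟨-, hzs⟩ := mem_filter.mp (mem_coe.mp hz)
      obtain ⟨-, hzs'⟩ := mem_filter.mp (mem_coe.mp hz')
      simp only at hzs hzs' h
      exact Prod.ext h (by rw [hzs, hzs'])
  -- the fibre bound, in `ℝ`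
  have hY₁r : (0 : ℝ) < Y₁ := by exact_mod_cast hY₁
  have hs2 : 0 < Real.sqrt (2 * Y₁) := Real.sqrt_pos.mpr (by positivity)
  have hdr : (0 : ℝ) < d := by exact_mod_cast hd
  have hτ1 : (1 : ℝ) ≤ #d.divisors := by exact_mod_cast one_le_card_divisors hd.ne'
  have hfib : ∀ s ∈ Icc (-(W : ℤ)) W, (g s : ℝ) ≤
      #d.divisors * (2 * ((Y₂ : ℝ) - Y₁) / (d * Real.sqrt (2 * Y₁)) + 5) := by
    intro s hs
    have hsW : 2 * s ^ 2 ≤ (Y₁ : ℤ) := by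
      rw [mem_Icc] at hs
      have : s ^ 2 ≤ (W : ℤ) ^ 2 := by nlinarith
      have hW' : 2 * (W : ℤ) ^ 2 ≤ Y₁ := by exact_mod_cast hW
      linarith
    have h := card_circFibre_le hd hsq hY s
    have hr : circRadius Y₁ s ≤ circRadius Y₂ s := circRadius_mono hY s
    have hdiv : (((circRadius Y₂ s - circRadius Y₁ s) / d : ℕ) : ℝ) ≤
        ((circRadius Y₂ s : ℝ) - circRadius Y₁ s) / d := by
      rw [← Nat.cast_sub hr]; exact Nat.cast_div_le
    have hsub := circRadius_sub_le hY hY₁ hsW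
    have hd1 : (1 : ℝ) / d ≤ 1 := by
      rw [div_le_one hdr]; exact_mod_cast hd
    calc (g s : ℝ) ≤ ((#d.divisors * (2 * ((circRadius Y₂ s - circRadius Y₁ s) / d + 1) + 1) : ℕ) : ℝ) := by
          exact_mod_cast h
      _ = #d.divisors * (2 * ((((circRadius Y₂ s - circRadius Y₁ s) / d : ℕ) : ℝ) + 1) + 1) := by
          push_cast; ring
      _ ≤ #d.divisors * (2 * (((circRadius Y₂ s : ℝ) - circRadius Y₁ s) / d + 1) + 1) := by gcongr
      _ ≤ #d.divisors * (2 * ((((Y₂ : ℝ) - Y₁) / Real.sqrt (2 * Y₁) + 1) / d + 1) + 1) := by gcongr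
      _ = #d.divisors * (2 * ((Y₂ : ℝ) - Y₁) / (d * Real.sqrt (2 * Y₁)) + 2 * (1 / d) + 3) := by
          field_simp; ring
      _ ≤ #d.divisors * (2 * ((Y₂ : ℝ) - Y₁) / (d * Real.sqrt (2 * Y₁)) + 2 * 1 + 3) := by gcongr
      _ = _ := by ring
  calc (#(axisStrip d W Y₁ Y₂) : ℝ) ≤ ((∑ s ∈ Icc (-(W : ℤ)) W, g s : ℕ) : ℝ) := by exact_mod_cast hslice
    _ = ∑ s ∈ Icc (-(W : ℤ)) W, (g s : ℝ) := by push_cast; rfl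
    _ ≤ ∑ s ∈ Icc (-(W : ℤ)) W, #d.divisors * (2 * ((Y₂ : ℝ) - Y₁) / (d * Real.sqrt (2 * Y₁)) + 5) :=
        sum_le_sum hfib
    _ = _ := by
        rw [sum_const, nsmul_eq_mul, Int.card_Icc]
        have : ((W : ℤ) + 1 - -(W : ℤ)).toNat = 2 * W + 1 := by omega
        rw [this]; push_cast; ring

/-- **Near-axis lattice points in residue classes**: for squarefree `d ≥ 1`, `1 ≤ Y₁ ≤ Y₂`, `2W² ≤ Y₁`,
`#{(r, s) near-axis in the annulus : d ∣ r² + s²} ≤ 2(2W + 1) τ(d) (2(Y₂ - Y₁)/(d√(2Y₁)) + 5)`.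
[cite: FriedlanderIwaniecAnnals1998, §5, proof of (5.16)] -/
theorem card_nearAxisSet_filter_dvd_le {d : ℕ} (hd : 0 < d) (hsq : Squarefree d) {W Y₁ Y₂ : ℕ}
    (hY : Y₁ ≤ Y₂) (hY₁ : 0 < Y₁) (hW : 2 * W ^ 2 ≤ Y₁) :
    (#((nearAxisSet W Y₁ Y₂).filter fun z => (d : ℤ) ∣ z.1 ^ 2 + z.2 ^ 2) : ℝ) ≤
      2 * ((2 * W + 1) * #d.divisors * (2 * ((Y₂ : ℝ) - Y₁) / (d * Real.sqrt (2 * Y₁)) + 5)) := by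
  calc (#((nearAxisSet W Y₁ Y₂).filter fun z => (d : ℤ) ∣ z.1 ^ 2 + z.2 ^ 2) : ℝ)
      ≤ ((2 * #(axisStrip d W Y₁ Y₂) : ℕ) : ℝ) := by exact_mod_cast card_nearAxisSet_filter_le d W Y₁ Y₂
    _ = 2 * (#(axisStrip d W Y₁ Y₂) : ℝ) := by push_cast; ring
    _ ≤ _ := by gcongr; exact card_axisStrip_le hd hsq hY hY₁ hW

/-! ### The divisor function summed over the near-axis points with squarefree norm -/

/-- **The near-axis divisor sum** (the counting behind "the other sectors, altogether of angle
`≤ 2πϑ`, contribute no more than the bound (4.23) by the estimate (5.16)"): for `1 ≤ Y₁ ≤ Y₂`,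
`2W² ≤ Y₁` and `D` at least every `d` with `d³ ≤ Y₂`,
`Σ_{(r,s) near-axis, Y₁ < r²+s² ≤ Y₂, r²+s² squarefree} τ(r² + s²)
  ≤ 18 (2W + 1)(1 + log D)⁴ (2(Y₂ - Y₁)/√(2Y₁) + 5D)`:
Lemma 2.2 (`τ(n) ≤ 9 Σ_{d ∣ n, d³ ≤ n} τ(d)`, `card_divisors_le_nine_mul_sum`), the class count
`card_nearAxisSet_filter_dvd_le`, and `Σ_{d ≤ D} τ(d)²/d ≤ (1 + log D)⁴` (`divPowSum_le`).
[cite: FriedlanderIwaniecAnnals1998, §5, proof of (5.16)] -/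
theorem sum_nearAxis_tau_le {W Y₁ Y₂ : ℕ} (hY : Y₁ ≤ Y₂) (hY₁ : 0 < Y₁) (hW : 2 * W ^ 2 ≤ Y₁)
    {D : ℕ} (hD : ∀ d : ℕ, 0 < d → d ^ 3 ≤ Y₂ → d ≤ D) :
    ∑ z ∈ (nearAxisSet W Y₁ Y₂).filter (fun z => Squarefree (z.1 ^ 2 + z.2 ^ 2).toNat),
        (#((z.1 ^ 2 + z.2 ^ 2).toNat.divisors) : ℝ) ≤
      18 * (2 * W + 1) * (1 + Real.log D) ^ 4 *
        (2 * ((Y₂ : ℝ) - Y₁) / Real.sqrt (2 * Y₁) + 5 * D) := by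
  set S := (nearAxisSet W Y₁ Y₂).filter (fun z => Squarefree (z.1 ^ 2 + z.2 ^ 2).toNat) with hS
  set DD := (Icc 1 D).filter Squarefree with hDD
  set L := (1 + Real.log D) ^ 4 with hL
  set X : ℝ := 2 * ((Y₂ : ℝ) - Y₁) / Real.sqrt (2 * Y₁) with hX
  set c : ℕ → ℝ := fun d =>
    (#((nearAxisSet W Y₁ Y₂).filter fun z => (d : ℤ) ∣ z.1 ^ 2 + z.2 ^ 2) : ℝ) with hc
  have hY₁r : (0 : ℝ) < Y₁ := by exact_mod_cast hY₁
  have hYr : (Y₁ : ℝ) ≤ Y₂ := by exact_mod_cast hY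
  have hX0 : 0 ≤ X := by
    have : 0 < Real.sqrt (2 * Y₁) := Real.sqrt_pos.mpr (by positivity)
    rw [hX]; exact div_nonneg (by linarith) this.le
  have hL0 : 0 ≤ L := by
    rw [hL]
    have : 0 ≤ 1 + Real.log D := by
      rcases Nat.eq_zero_or_pos D with h | h
      · simp [h]
      · have : (1 : ℝ) ≤ D := by exact_mod_cast h
        linarith [Real.log_nonneg this]
    positivity
  -- Steps 1–2: Lemma 2.2 pointwise, small divisors inside `DD`
  have hpt : ∀ z ∈ S, (#((z.1 ^ 2 + z.2 ^ 2).toNat.divisors) : ℝ) ≤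
      9 * ∑ d ∈ DD, (if (d : ℤ) ∣ z.1 ^ 2 + z.2 ^ 2 then (#d.divisors : ℝ) else 0) := by
    intro z hz
    obtain ⟨hzN, hsq⟩ := mem_filter.mp hz
    obtain ⟨-, -, h1, h2⟩ := mem_filter.mp hzN
    set n := (z.1 ^ 2 + z.2 ^ 2).toNat with hn
    have hnz : (n : ℤ) = z.1 ^ 2 + z.2 ^ 2 := Int.toNat_of_nonneg (by positivity)
    refine (card_divisors_le_nine_mul_sum hsq).trans ?_
    refine mul_le_mul_of_nonneg_left ?_ (by norm_num)
    rw [← sum_filter]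
    refine sum_le_sum_of_subset_of_nonneg (fun d hd => ?_) (fun _ _ _ => Nat.cast_nonneg _)
    obtain ⟨hdn, hd3⟩ := mem_filter.mp hd
    have hd0 : 0 < d := Nat.pos_of_mem_divisors hdn
    have hdvd : d ∣ n := Nat.dvd_of_mem_divisors hdn
    have hnY : n ≤ Y₂ := by
      have : (n : ℤ) ≤ Y₂ := by rw [hnz]; exact h2
      exact_mod_cast this
    have hdD : d ≤ D := hD d hd0 (hd3.trans hnY)
    have hdsq : Squarefree d := Squarefree.squarefree_of_dvd hdvd hsq
    have hdz : (d : ℤ) ∣ z.1 ^ 2 + z.2 ^ 2 := by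
      rw [← hnz]; exact Int.natCast_dvd_natCast.mpr hdvd
    exact mem_filter.mpr ⟨mem_filter.mpr ⟨mem_Icc.mpr ⟨hd0, hdD⟩, hdsq⟩, hdz⟩
  -- Step 3: swap the sums
  have hswap : ∑ z ∈ S, ∑ d ∈ DD, (if (d : ℤ) ∣ z.1 ^ 2 + z.2 ^ 2 then (#d.divisors : ℝ) else 0)
      = ∑ d ∈ DD, (#d.divisors : ℝ) * #(S.filter fun z => (d : ℤ) ∣ z.1 ^ 2 + z.2 ^ 2) := by
    rw [sum_comm]
    refine sum_congr rfl fun d _ => ?_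
    rw [← sum_filter, sum_const, nsmul_eq_mul, mul_comm]
  have hSc : ∀ d : ℕ, (#(S.filter fun z => (d : ℤ) ∣ z.1 ^ 2 + z.2 ^ 2) : ℝ) ≤ c d := by
    intro d
    simp only [hc, hS]
    exact_mod_cast card_le_card (filter_subset_filter _ (filter_subset _ (nearAxisSet W Y₁ Y₂)))
  -- Step 4: the class count for `d ∈ DD`
  have hcd : ∀ d ∈ DD, c d ≤ 2 * ((2 * W + 1) * #d.divisors * (X / d + 5)) := by
    intro d hd
    obtain ⟨hdI, hdsq⟩ := mem_filter.mp hd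
    have hd0 : 0 < d := (mem_Icc.mp hdI).1
    have h := card_nearAxisSet_filter_dvd_le hd0 hdsq hY hY₁ hW
    have e : 2 * ((Y₂ : ℝ) - Y₁) / (d * Real.sqrt (2 * Y₁)) = X / d := by
      rw [hX]; field_simp
    rw [hc]; rw [e] at h; exact h
  -- Step 5: the divisor moments
  have hmom : ∑ d ∈ DD, (#d.divisors : ℝ) ^ 2 * (X / d + 5) ≤ (X + 5 * D) * L := by
    have h1 : ∀ d ∈ DD, (#d.divisors : ℝ) ^ 2 * (X / d + 5) ≤
        (X + 5 * D) * ((#d.divisors : ℝ) ^ 2 / d) := by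
      intro d hd
      obtain ⟨hdI, -⟩ := mem_filter.mp hd
      obtain ⟨hd0, hdD⟩ := mem_Icc.mp hdI
      have hdr : (0 : ℝ) < d := by exact_mod_cast hd0
      have hdDr : (d : ℝ) ≤ D := by exact_mod_cast hdD
      rw [div_add' _ _ _ hdr.ne', mul_div_assoc', mul_div_assoc', div_le_div_iff_of_pos_right hdr]
      have hτ : 0 ≤ (#d.divisors : ℝ) ^ 2 := by positivity
      nlinarith
    calc ∑ d ∈ DD, (#d.divisors : ℝ) ^ 2 * (X / d + 5)
        ≤ ∑ d ∈ DD, (X + 5 * D) * ((#d.divisors : ℝ) ^ 2 / d) := sum_le_sum h1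
      _ = (X + 5 * D) * ∑ d ∈ DD, (#d.divisors : ℝ) ^ 2 / d := by rw [mul_sum]
      _ ≤ (X + 5 * D) * divPowSum 2 D := by
          refine mul_le_mul_of_nonneg_left ?_ (by positivity)
          unfold divPowSum
          exact sum_le_sum_of_subset_of_nonneg (filter_subset _ _) fun _ _ _ => by positivity
      _ ≤ (X + 5 * D) * L := mul_le_mul_of_nonneg_left (divPowSum_le 2 D) (by positivity)
  -- assemble
  calc ∑ z ∈ S, (#((z.1 ^ 2 + z.2 ^ 2).toNat.divisors) : ℝ)
      ≤ ∑ z ∈ S, 9 * ∑ d ∈ DD, (if (d : ℤ) ∣ z.1 ^ 2 + z.2 ^ 2 then (#d.divisors : ℝ) else 0) :=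
        sum_le_sum hpt
    _ = 9 * ∑ d ∈ DD, (#d.divisors : ℝ) * #(S.filter fun z => (d : ℤ) ∣ z.1 ^ 2 + z.2 ^ 2) := by
        rw [← mul_sum, hswap]
    _ ≤ 9 * ∑ d ∈ DD, (#d.divisors : ℝ) * (2 * ((2 * W + 1) * #d.divisors * (X / d + 5))) := by
        gcongr with d hd
        exact (hSc d).trans (hcd d hd)
    _ = 18 * (2 * W + 1) * ∑ d ∈ DD, (#d.divisors : ℝ) ^ 2 * (X / d + 5) := by
        rw [mul_sum, mul_sum]
        refine sum_congr rfl fun d _ => ?_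
        ring
    _ ≤ 18 * (2 * W + 1) * ((X + 5 * D) * L) := by gcongr
    _ = 18 * (2 * W + 1) * (1 + Real.log D) ^ 4 * (X + 5 * D) := by rw [hL]; ring

/-! ### Angles: sectors touching an axis, and the coordinates of `z` near an axis -/

/-- **A sector not certified off-axis lies near an axis.** If the sector `(φ, φ + w]` is NOT inside
an open quadrant at distance `> ϑ'` from the axes (the negation of the side condition of
`FriedlanderIwaniec1998_bilinear515`), then every angle `u` in the sector modulo `2π` is within
`ϑ' + w` of a multiple of `π/2`. [cite: FriedlanderIwaniecAnnals1998, §5, "We can assume that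
`|φ (mod π/2)| > πϑ` because the other sectors, altogether of angle `≤ 2πϑ` …"] -/
theorem exists_abs_sub_mul_pi_div_two_le {φ w ϑ' u : ℝ}
    (hbad : ¬ ∃ k : ℤ, k * (Real.pi / 2) + ϑ' < φ ∧ φ + w < (k + 1) * (Real.pi / 2) - ϑ')
    (hu : ∃ k : ℤ, φ < u - 2 * Real.pi * k ∧ u - 2 * Real.pi * k ≤ φ + w) :
    ∃ k : ℤ, |u - k * (Real.pi / 2)| ≤ ϑ' + w := by
  obtain ⟨k', hu1, hu2⟩ := hu
  have hπ : 0 < Real.pi / 2 := by positivity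
  set t : ℝ := (φ - ϑ') / (Real.pi / 2) with ht
  set k : ℤ := ⌈t⌉ - 1 with hk
  have hk1 : (k : ℝ) < t := by
    rw [hk]; push_cast; linarith [Int.ceil_lt_add_one t]
  have hk2 : t ≤ (k : ℝ) + 1 := by
    rw [hk]; push_cast; linarith [Int.le_ceil t]
  have hk1' : k * (Real.pi / 2) + ϑ' < φ := by
    have := (lt_div_iff₀ hπ).mp hk1
    linarith
  have hk2' : φ ≤ (k + 1) * (Real.pi / 2) + ϑ' := by
    have := (div_le_iff₀ hπ).mp hk2
    linarith
  have hφ : (k + 1) * (Real.pi / 2) - ϑ' ≤ φ + w := by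
    by_contra h
    exact hbad ⟨k, hk1', lt_of_not_ge h⟩
  refine ⟨k + 1 + 4 * k', ?_⟩
  rw [abs_le]
  constructor
  · push_cast; nlinarith
  · push_cast; nlinarith

/-- `|(-1)^j t| = |t|` for an integer exponent. [folklore] -/
theorem abs_neg_one_zpow_mul (j : ℤ) (t : ℝ) : |(-1 : ℝ) ^ j * t| = |t| := by
  rw [abs_mul, abs_zpow, abs_neg, abs_one, one_zpow, one_mul]

/-- **Near an axis, one coordinate is small**: if `arg z` is within `ϖ` of a multiple of `π/2`
then `|re z| ≤ ϖ |z|` or `|im z| ≤ ϖ |z|` (`|sin v| ≤ |v|`).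
[cite: FriedlanderIwaniecAnnals1998, §5, "For `z = r + is` in any remaining polar box we are not
near either axis, and hence `ϑ√N < |r|, |s|`" (contrapositive form)] -/
theorem abs_re_le_or_abs_im_le_of_arg {z : GaussianInt} {ϖ : ℝ} {k : ℤ}
    (h : |gaussArg z - k * (Real.pi / 2)| ≤ ϖ) :
    |(z.re : ℝ)| ≤ ϖ * Real.sqrt z.norm ∨ |(z.im : ℝ)| ≤ ϖ * Real.sqrt z.norm := by
  set c : ℂ := GaussianInt.toComplex z with hc
  set u : ℝ := Complex.arg c with hu
  have hgu : gaussArg z = u := rfl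
  rw [hgu] at h
  have hnorm : Real.sqrt (z.norm : ℝ) = ‖c‖ := by
    have e : ((z.norm : ℤ) : ℝ) = ‖c‖ ^ 2 := by
      rw [Zsqrtd.norm_def, hc, Complex.sq_norm, Complex.normSq_apply]
      push_cast
      simp
    rw [e, Real.sqrt_sq (norm_nonneg _)]
  have hre : (z.re : ℝ) = ‖c‖ * Real.cos u := by
    rw [hu, Complex.norm_mul_cos_arg, hc]; simp
  have him : (z.im : ℝ) = ‖c‖ * Real.sin u := by
    rw [hu, Complex.norm_mul_sin_arg, hc]; simp
  have hc0 : 0 ≤ ‖c‖ := norm_nonneg _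
  rw [hnorm]
  obtain ⟨j, hj | hj⟩ := Int.even_or_odd' k
  · -- `k = 2j`: `|sin u| = |sin (u - jπ)| ≤ |u - jπ| ≤ ϖ`
    right
    have hv : |u - j * Real.pi| ≤ ϖ := by
      have e : u - j * Real.pi = u - k * (Real.pi / 2) := by rw [hj]; push_cast; ring
      rwa [e]
    have hsin : |Real.sin u| ≤ ϖ := by
      have e : Real.sin u = (-1 : ℝ) ^ j * Real.sin (u - j * Real.pi) := by
        have := Real.sin_add_int_mul_pi (u - j * Real.pi) j
        rw [show u - j * Real.pi + j * Real.pi = u by ring] at this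
        exact this
      rw [e, abs_neg_one_zpow_mul]
      exact (Real.abs_sin_le_abs).trans hv
    rw [him, abs_mul, abs_of_nonneg hc0, mul_comm]
    exact mul_le_mul_of_nonneg_right hsin hc0
  · -- `k = 2j + 1`: `|cos u| = |sin (u - (2j+1)π/2)| ≤ ϖ`
    left
    set v : ℝ := u - (2 * j + 1) * (Real.pi / 2) with hvdef
    have hv : |v| ≤ ϖ := by
      have e : v = u - k * (Real.pi / 2) := by rw [hvdef, hj]; push_cast; ring
      rwa [e]
    have hcos : |Real.cos u| ≤ ϖ := by
      have e : Real.cos u = (-1 : ℝ) ^ j * (-Real.sin v) := by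
        have h1 := Real.cos_add_int_mul_pi (v + Real.pi / 2) j
        rw [Real.cos_add_pi_div_two] at h1
        rw [← h1]; congr 1; rw [hvdef]; ring
      rw [e, abs_neg_one_zpow_mul, abs_neg]
      exact (Real.abs_sin_le_abs).trans hv
    rw [hre, abs_mul, abs_of_nonneg hc0, mul_comm]
    exact mul_le_mul_of_nonneg_right hcos hc0

/-! ### Glue: Gaussian coordinates, the `w`-annulus, primitive `z`, and box counts -/

/-- The `w`-range of (4.18)/(5.19) as one set of lattice points: `{(u, v) : M₁ < u² + v² ≤ M₂}`.
[cite: FriedlanderIwaniecAnnals1998, (4.18)] -/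
def wAnnulus (M₁ M₂ : ℕ) : Finset (ℤ × ℤ) :=
  (fiBox M₂).filter fun uv => (M₁ : ℤ) < uv.1 ^ 2 + uv.2 ^ 2 ∧ uv.1 ^ 2 + uv.2 ^ 2 ≤ (M₂ : ℤ)

/-- Points of `wAnnulus M₁ M₂` lie in the disc `u² + v² ≤ M₂`. [folklore] -/
theorem sq_add_sq_le_of_mem_wAnnulus {M₁ M₂ : ℕ} {uv : ℤ × ℤ} (h : uv ∈ wAnnulus M₁ M₂) :
    uv.1 ^ 2 + uv.2 ^ 2 ≤ (M₂ : ℤ) :=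
  (mem_filter.mp h).2.2

/-- `Σ_{M₁ < m ≤ M₂} Σ_{|w|² = m} f(w) = Σ_{w ∈ wAnnulus M₁ M₂} f(w)` (grouping by the norm).
[folklore] -/
theorem sum_Ioc_sum_sqPairs {β : Type*} [AddCommMonoid β] (M₁ M₂ : ℕ) (f : ℤ × ℤ → β) :
    ∑ m ∈ Ioc M₁ M₂, ∑ uv ∈ sqPairs m, f uv = ∑ uv ∈ wAnnulus M₁ M₂, f uv := by
  have hmaps : ((wAnnulus M₁ M₂ : Finset (ℤ × ℤ)) : Set (ℤ × ℤ)).MapsTo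
      (fun uv => (uv.1 ^ 2 + uv.2 ^ 2).toNat) ((Ioc M₁ M₂ : Finset ℕ) : Set ℕ) := by
    intro uv huv
    obtain ⟨-, h1, h2⟩ := mem_filter.mp (mem_coe.mp huv)
    have h0 : 0 ≤ uv.1 ^ 2 + uv.2 ^ 2 := by positivity
    have e : (((uv.1 ^ 2 + uv.2 ^ 2).toNat : ℕ) : ℤ) = uv.1 ^ 2 + uv.2 ^ 2 := Int.toNat_of_nonneg h0
    rw [mem_coe, mem_Ioc]
    constructor
    · have : (M₁ : ℤ) < ((uv.1 ^ 2 + uv.2 ^ 2).toNat : ℕ) := by rw [e]; exact h1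
      exact_mod_cast this
    · have : (((uv.1 ^ 2 + uv.2 ^ 2).toNat : ℕ) : ℤ) ≤ M₂ := by rw [e]; exact h2
      exact_mod_cast this
  rw [← sum_fiberwise_of_maps_to hmaps]
  refine sum_congr rfl fun m hm => ?_
  obtain ⟨hm1, hm2⟩ := mem_Ioc.mp hm
  congr 1
  ext uv
  simp only [mem_filter, mem_sqPairs]
  symm
  constructor
  · intro h
    have h' := h.2
    have h0 : 0 ≤ uv.1 ^ 2 + uv.2 ^ 2 := by positivity
    have e := Int.toNat_of_nonneg h0
    rw [h'] at e
    exact e.symm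
  · intro h
    have hm2' : (m : ℤ) ≤ M₂ := by exact_mod_cast hm2
    have hm1' : (M₁ : ℤ) < m := by exact_mod_cast hm1
    refine ⟨mem_filter.mpr ⟨?_, ?_, ?_⟩, ?_⟩
    · have h1 : uv.1 ^ 2 ≤ (M₂ : ℤ) := by nlinarith [sq_nonneg uv.2]
      have h2 : uv.2 ^ 2 ≤ (M₂ : ℤ) := by nlinarith [sq_nonneg uv.1]
      have := mem_fiBox_of_sq_le h1 h2
      simpa using this
    · rw [h]; exact hm1'
    · rw [h]; exact hm2'
    · rw [h]; simp

/-- For `z` of norm `n`: `max(|re z|, |im z|)² ≥ n/2`, so `2 max² ≥ n`. [folklore] -/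
theorem le_two_mul_max_natAbs_sq {z : GaussianInt} {n : ℕ} (hz : z.norm = n) :
    n ≤ 2 * (max z.re.natAbs z.im.natAbs) ^ 2 := by
  have e : (n : ℤ) = z.re ^ 2 + z.im ^ 2 := by rw [← hz, Zsqrtd.norm_def]; ring
  have h1 : z.re ^ 2 = (z.re.natAbs : ℤ) ^ 2 := (Int.natAbs_sq z.re).symm
  have h2 : z.im ^ 2 = (z.im.natAbs : ℤ) ^ 2 := (Int.natAbs_sq z.im).symm
  have hm1 : z.re.natAbs ≤ max z.re.natAbs z.im.natAbs := le_max_left _ _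
  have hm2 : z.im.natAbs ≤ max z.re.natAbs z.im.natAbs := le_max_right _ _
  have : (n : ℤ) ≤ 2 * ((max z.re.natAbs z.im.natAbs : ℕ) : ℤ) ^ 2 := by
    rw [e, h1, h2]
    have hm1' : (z.re.natAbs : ℤ) ≤ (max z.re.natAbs z.im.natAbs : ℕ) := by exact_mod_cast hm1
    have hm2' : (z.im.natAbs : ℤ) ≤ (max z.re.natAbs z.im.natAbs : ℕ) := by exact_mod_cast hm2
    nlinarith [Int.natCast_nonneg z.re.natAbs, Int.natCast_nonneg z.im.natAbs]
  exact_mod_cast this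

/-- All primary `z` with `Y₁ < |z|² ≤ Y₂` together are at most `(2⌊√Y₂⌋ + 1)²` lattice points.
[folklore] -/
theorem sum_card_primaryNormEq_le (Y₁ Y₂ : ℕ) :
    ∑ n ∈ Ioc Y₁ Y₂, #(Literature.NumberTheory.QuadraticFields.GaussianPrimary.primaryNormEq n) ≤
      (2 * Nat.sqrt Y₂ + 1) ^ 2 := by
  classical
  set R : ℤ := (Nat.sqrt Y₂ : ℤ) with hR
  rw [← card_sigma]
  have hbox : #((Icc (-R) R) ×ˢ (Icc (-R) R)) = (2 * Nat.sqrt Y₂ + 1) ^ 2 := by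
    rw [card_product, Int.card_Icc]
    have : (R + 1 - -R).toNat = 2 * Nat.sqrt Y₂ + 1 := by rw [hR]; omega
    rw [this]; ring
  rw [← hbox]
  refine card_le_card_of_injOn (fun x => (x.2.re, x.2.im)) ?_ ?_
  · intro x hx
    obtain ⟨hn, hz⟩ := mem_sigma.mp (mem_coe.mp hx)
    obtain ⟨hzn, -⟩ := Literature.NumberTheory.QuadraticFields.GaussianPrimary.mem_primaryNormEq.mp hz
    have hnY : (x.1 : ℤ) ≤ Y₂ := by exact_mod_cast (mem_Ioc.mp hn).2
    have e : x.2.re ^ 2 + x.2.im ^ 2 ≤ (Y₂ : ℤ) := by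
      have : x.2.norm = x.2.re ^ 2 + x.2.im ^ 2 := by rw [Zsqrtd.norm_def]; ring
      rw [← this, hzn]; exact hnY
    have e' : x.2.im ^ 2 + x.2.re ^ 2 ≤ (Y₂ : ℤ) := by rwa [add_comm]
    exact mem_coe.mpr (mem_product.mpr ⟨mem_Icc_sqrt_of_sq_add_sq_le e, mem_Icc_sqrt_of_sq_add_sq_le e'⟩)
  · intro x hx y hy h
    obtain ⟨-, hxz⟩ := mem_sigma.mp (mem_coe.mp hx)
    obtain ⟨-, hyz⟩ := mem_sigma.mp (mem_coe.mp hy)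
    obtain ⟨hxn, -⟩ := Literature.NumberTheory.QuadraticFields.GaussianPrimary.mem_primaryNormEq.mp hxz
    obtain ⟨hyn, -⟩ := Literature.NumberTheory.QuadraticFields.GaussianPrimary.mem_primaryNormEq.mp hyz
    simp only [Prod.mk.injEq] at h
    have hz : x.2 = y.2 := Zsqrtd.ext h.1 h.2
    have hn : x.1 = y.1 := by
      have : (x.1 : ℤ) = y.1 := by rw [← hxn, ← hyn, hz]
      exact_mod_cast this
    exact Sigma.ext hn (heq_of_eq hz)

/-- Transport of a sum of nonnegative reals along an injection: `Σ_{i ∈ s} f i ≤ Σ_{j ∈ t} g j` if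
`e` maps `s` injectively into `t` with `f i ≤ g (e i)` and `g ≥ 0` on `t`. [folklore] -/
theorem sum_le_sum_of_injOn_real {ι κ : Type*} [DecidableEq κ] {s : Finset ι} {t : Finset κ}
    (e : ι → κ) (he : Set.InjOn e s) (hst : ∀ i ∈ s, e i ∈ t) {f : ι → ℝ} {g : κ → ℝ}
    (hg : ∀ j ∈ t, 0 ≤ g j) (hfg : ∀ i ∈ s, f i ≤ g (e i)) :
    ∑ i ∈ s, f i ≤ ∑ j ∈ t, g j := by
  calc ∑ i ∈ s, f i ≤ ∑ i ∈ s, g (e i) := sum_le_sum hfg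
    _ = ∑ j ∈ s.image e, g j := (sum_image he).symm
    _ ≤ ∑ j ∈ t, g j := by
        refine sum_le_sum_of_subset_of_nonneg (fun j hj => ?_) fun j hj _ => hg j hj
        obtain ⟨i, hi, rfl⟩ := mem_image.mp hj
        exact hst i hi

/-- From primary `z` grouped by the norm to lattice points: for any property `Q` of lattice points,
`Σ_{Y₁ < n ≤ Y₂, n squarefree} τ(n) #{z primary : |z|² = n, Q(re z, im z)}
  ≤ Σ_{(r,s) ∈ [-Y₂,Y₂]², Y₁ < r²+s² ≤ Y₂, Q, r²+s² squarefree} τ(r² + s²)`. [folklore] -/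
theorem sum_card_primary_filter_le {Y₁ Y₂ : ℕ} (Q : ℤ × ℤ → Prop) [DecidablePred Q] :
    ∑ n ∈ (Ioc Y₁ Y₂).filter Squarefree, (#n.divisors : ℝ) *
        #((Literature.NumberTheory.QuadraticFields.GaussianPrimary.primaryNormEq n).filter
            fun z => Q (z.re, z.im)) ≤
      ∑ z ∈ ((Icc (-(Y₂ : ℤ)) Y₂) ×ˢ (Icc (-(Y₂ : ℤ)) Y₂)).filter (fun z =>
          Q z ∧ (Y₁ : ℤ) < z.1 ^ 2 + z.2 ^ 2 ∧ z.1 ^ 2 + z.2 ^ 2 ≤ (Y₂ : ℤ) ∧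
            Squarefree (z.1 ^ 2 + z.2 ^ 2).toNat),
        (#((z.1 ^ 2 + z.2 ^ 2).toNat.divisors) : ℝ) := by
  classical
  -- write the left side as a sum over the pairs `(n, z)`
  have e1 : ∑ n ∈ (Ioc Y₁ Y₂).filter Squarefree, (#n.divisors : ℝ) *
      #((Literature.NumberTheory.QuadraticFields.GaussianPrimary.primaryNormEq n).filter
          fun z => Q (z.re, z.im)) =
      ∑ x ∈ ((Ioc Y₁ Y₂).filter Squarefree).sigma (fun n =>
          (Literature.NumberTheory.QuadraticFields.GaussianPrimary.primaryNormEq n).filter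
            fun z => Q (z.re, z.im)), (#x.1.divisors : ℝ) := by
    rw [sum_sigma]
    refine sum_congr rfl fun n _ => ?_
    simp only [sum_const, nsmul_eq_mul, mul_comm]
  rw [e1]
  refine sum_le_sum_of_injOn_real (fun x => (x.2.re, x.2.im)) ?_ ?_ (fun _ _ => Nat.cast_nonneg _) ?_
  · intro x hx y hy h
    obtain ⟨-, hxz⟩ := mem_sigma.mp (mem_coe.mp hx)
    obtain ⟨-, hyz⟩ := mem_sigma.mp (mem_coe.mp hy)
    obtain ⟨hxn, -⟩ := Literature.NumberTheory.QuadraticFields.GaussianPrimary.mem_primaryNormEq.mp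
      (mem_filter.mp hxz).1
    obtain ⟨hyn, -⟩ := Literature.NumberTheory.QuadraticFields.GaussianPrimary.mem_primaryNormEq.mp
      (mem_filter.mp hyz).1
    simp only [Prod.mk.injEq] at h
    have hz : x.2 = y.2 := Zsqrtd.ext h.1 h.2
    have hn : x.1 = y.1 := by
      have : (x.1 : ℤ) = y.1 := by rw [← hxn, ← hyn, hz]
      exact_mod_cast this
    exact Sigma.ext hn (heq_of_eq hz)
  · intro x hx
    obtain ⟨hn, hz⟩ := mem_sigma.mp hx
    obtain ⟨hnI, hsq⟩ := mem_filter.mp hn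
    obtain ⟨hz1, hQ⟩ := mem_filter.mp hz
    obtain ⟨hzn, -⟩ := Literature.NumberTheory.QuadraticFields.GaussianPrimary.mem_primaryNormEq.mp hz1
    obtain ⟨hn1, hn2⟩ := mem_Ioc.mp hnI
    have en : x.2.re ^ 2 + x.2.im ^ 2 = (x.1 : ℤ) := by
      rw [← hzn, Zsqrtd.norm_def]; ring
    have hn1' : (Y₁ : ℤ) < x.1 := by exact_mod_cast hn1
    have hn2' : (x.1 : ℤ) ≤ Y₂ := by exact_mod_cast hn2
    refine mem_filter.mpr ⟨?_, hQ, ?_, ?_, ?_⟩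
    · have h1 : x.2.re ^ 2 ≤ (Y₂ : ℤ) := by nlinarith [sq_nonneg x.2.im]
      have h2 : x.2.im ^ 2 ≤ (Y₂ : ℤ) := by nlinarith [sq_nonneg x.2.re]
      have := mem_fiBox_of_sq_le h1 h2
      simpa [fiBox] using this
    · rw [en]; exact hn1'
    · rw [en]; exact hn2'
    · rw [en, Int.toNat_natCast]; exact hsq
  · intro x hx
    obtain ⟨-, hz⟩ := mem_sigma.mp hx
    obtain ⟨hz1, -⟩ := mem_filter.mp hz
    obtain ⟨hzn, -⟩ := Literature.NumberTheory.QuadraticFields.GaussianPrimary.mem_primaryNormEq.mp hz1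
    have en : x.2.re ^ 2 + x.2.im ^ 2 = (x.1 : ℤ) := by
      rw [← hzn, Zsqrtd.norm_def]; ring
    simp only [en, Int.toNat_natCast]
    exact le_rfl


/-! ## Part 2: the splitting identities -/

/-! ### The free form with an angular weight, and the complementary form -/

/-- FI's free form `ℬ(M, N)` of (5.10) with the angular weight `q` of (5.13) attached (but no class
condition (5.7)): `Σ_{M < |w|² ≤ 2M} Σ_{z primary, N' < |z|² ≤ (1+θ)N'} α(|w|²) q(arg z) β(|z|²) 𝔷(Re w̄ z)`,
grouped by the norms. For `q = 1` this is the free form `ℬ(M, N)` itself.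
[cite: FriedlanderIwaniecAnnals1998, (5.10) and (5.13)] -/
def fiFreeSector (α : ℕ → ℂ) (q p : ℝ → ℝ) (M N' θ C P τ : ℝ) : ℂ :=
  ∑ m ∈ Ioc ⌊M⌋₊ ⌊2 * M⌋₊, ∑ n ∈ Ioc ⌊N'⌋₊ ⌊(1 + θ) * N'⌋₊,
    α m * ((fiBeta p C P τ n : ℝ) : ℂ) *
      ((∑ uv ∈ sqPairs m, ∑ z ∈ primaryNormEq n,
          q (gaussArg z) * (fiZeta (star (toGauss uv) * z).re : ℝ) : ℝ) : ℂ)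

/-- `fiFreeSector` unfolded. [cite: FriedlanderIwaniecAnnals1998, (5.10) and (5.13)] -/
theorem fiFreeSector_def (α : ℕ → ℂ) (q p : ℝ → ℝ) (M N' θ C P τ : ℝ) :
    fiFreeSector α q p M N' θ C P τ =
      ∑ m ∈ Ioc ⌊M⌋₊ ⌊2 * M⌋₊, ∑ n ∈ Ioc ⌊N'⌋₊ ⌊(1 + θ) * N'⌋₊,
        α m * ((fiBeta p C P τ n : ℝ) : ℂ) *
          ((∑ uv ∈ sqPairs m, ∑ z ∈ primaryNormEq n,
              q (gaussArg z) * (fiZeta (star (toGauss uv) * z).re : ℝ) : ℝ) : ℂ) := rfl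

/-- The complementary form `ℬ̃(M, N) = Σ_{(w w̄, z z̄) ≠ 1} α_w β_z 𝔷(Re w̄ z)` of the proof of (5.10),
grouped by the norms. [cite: FriedlanderIwaniecAnnals1998, §5, proof of (5.10)] -/
def fiGaussCompl (α : ℕ → ℂ) (p : ℝ → ℝ) (M N' θ C P τ : ℝ) : ℂ :=
  ∑ m ∈ Ioc ⌊M⌋₊ ⌊2 * M⌋₊,
    ∑ n ∈ (Ioc ⌊N'⌋₊ ⌊(1 + θ) * N'⌋₊).filter (fun n : ℕ => ¬ n.Coprime m),
      α m * ((fiBeta p C P τ n : ℝ) : ℂ) *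
        ((∑ uv ∈ sqPairs m, ∑ z ∈ primaryNormEq n, fiZeta (star (toGauss uv) * z).re : ℕ) : ℂ)

/-- `fiGaussCompl` unfolded. [cite: FriedlanderIwaniecAnnals1998, §5, proof of (5.10)] -/
theorem fiGaussCompl_def (α : ℕ → ℂ) (p : ℝ → ℝ) (M N' θ C P τ : ℝ) :
    fiGaussCompl α p M N' θ C P τ = ∑ m ∈ Ioc ⌊M⌋₊ ⌊2 * M⌋₊,
      ∑ n ∈ (Ioc ⌊N'⌋₊ ⌊(1 + θ) * N'⌋₊).filter (fun n : ℕ => ¬ n.Coprime m),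
        α m * ((fiBeta p C P τ n : ℝ) : ℂ) *
          ((∑ uv ∈ sqPairs m, ∑ z ∈ primaryNormEq n, fiZeta (star (toGauss uv) * z).re : ℕ) : ℂ) :=
  rfl

/-- **(5.6) + complementary form = free form**: `ℬ*(M, N) + ℬ̃(M, N) = ℬ(M, N)` (the form with
`(w w̄, z z̄) = 1`, plus the one with `(w w̄, z z̄) ≠ 1`, is the free form with `q = 1`).
[cite: FriedlanderIwaniecAnnals1998, §5, proof of (5.10)] -/
theorem fiGaussStar_add_fiGaussCompl (α : ℕ → ℂ) (p : ℝ → ℝ) (M N' θ C P τ : ℝ) :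
    fiGaussStar α p M N' θ C P τ + fiGaussCompl α p M N' θ C P τ =
      fiFreeSector α (fun _ => 1) p M N' θ C P τ := by
  unfold fiGaussStar fiGaussCompl fiFreeSector
  rw [← sum_add_distrib]
  refine sum_congr rfl fun m _ => ?_
  rw [sum_filter_add_sum_filter_not]
  refine sum_congr rfl fun n _ => ?_
  congr 1
  push_cast
  simp

/-! ### Linearity in the angular weight -/

/-- `fiFreeSector` is additive in `q`. [folklore] -/
theorem fiFreeSector_add (α : ℕ → ℂ) (q₁ q₂ p : ℝ → ℝ) (M N' θ C P τ : ℝ) :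
    fiFreeSector α (fun u => q₁ u + q₂ u) p M N' θ C P τ =
      fiFreeSector α q₁ p M N' θ C P τ + fiFreeSector α q₂ p M N' θ C P τ := by
  unfold fiFreeSector
  rw [← sum_add_distrib]
  refine sum_congr rfl fun m _ => ?_
  rw [← sum_add_distrib]
  refine sum_congr rfl fun n _ => ?_
  rw [← mul_add, ← Complex.ofReal_add, ← sum_add_distrib]
  congr 2
  refine sum_congr rfl fun uv _ => ?_
  rw [← sum_add_distrib]
  refine sum_congr rfl fun z _ => ?_
  ring

/-- `fiFreeSector` of a finite sum of weights. [folklore] -/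
theorem fiFreeSector_sum {ι : Type*} (s : Finset ι) (α : ℕ → ℂ) (q : ι → ℝ → ℝ) (p : ℝ → ℝ)
    (M N' θ C P τ : ℝ) :
    fiFreeSector α (fun u => ∑ j ∈ s, q j u) p M N' θ C P τ =
      ∑ j ∈ s, fiFreeSector α (q j) p M N' θ C P τ := by
  classical
  induction s using Finset.induction_on with
  | empty =>
    simp only [sum_empty]
    unfold fiFreeSector
    simp
  | insert j s hj ih =>
    rw [sum_insert hj, ← ih, ← fiFreeSector_add]
    congr 1
    funext u
    rw [sum_insert hj]

/-- `fiGaussSector` is homogeneous in `q`. [folklore] -/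
theorem fiGaussSector_const_mul (c : ℝ) (α : ℕ → ℂ) (q p : ℝ → ℝ) (z₀ : GaussianInt)
    (M N' θ C P τ : ℝ) :
    fiGaussSector α (fun u => c * q u) p z₀ M N' θ C P τ =
      (c : ℂ) * fiGaussSector α q p z₀ M N' θ C P τ := by
  unfold fiGaussSector
  rw [mul_sum]
  refine sum_congr rfl fun m _ => ?_
  rw [mul_sum]
  refine sum_congr rfl fun n _ => ?_
  have e : (∑ uv ∈ sqPairs m, ∑ z ∈ (primaryNormEq n).filter (GaussCongrEight z₀),
      c * q (gaussArg z) * (fiZeta (star (toGauss uv) * z).re : ℝ)) =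
      c * ∑ uv ∈ sqPairs m, ∑ z ∈ (primaryNormEq n).filter (GaussCongrEight z₀),
        q (gaussArg z) * (fiZeta (star (toGauss uv) * z).re : ℝ) := by
    rw [mul_sum]
    refine sum_congr rfl fun uv _ => ?_
    rw [mul_sum]
    refine sum_congr rfl fun z _ => ?_
    ring
  rw [e, Complex.ofReal_mul]
  ring

/-! ### Splitting into classes modulo `8` -/

/-- Representatives of `ℤ[i]` modulo `8`: `a + bi`, `0 ≤ a, b < 8`.
[cite: FriedlanderIwaniecAnnals1998, (5.7), "This can be accomplished by splitting `ℬ*(M, N)` into … classes"] -/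
def gaussReps8 : Finset GaussianInt :=
  ((range 8) ×ˢ (range 8)).image fun ab : ℕ × ℕ => (⟨(ab.1 : ℤ), (ab.2 : ℤ)⟩ : GaussianInt)

/-- There are at most `64` representatives. [folklore] -/
theorem card_gaussReps8_le : #gaussReps8 ≤ 64 := by
  unfold gaussReps8
  refine card_image_le.trans ?_
  simp

/-- The representative of `z` modulo `8`. [folklore] -/
def gaussRep8 (z : GaussianInt) : GaussianInt := ⟨z.re % 8, z.im % 8⟩

/-- `gaussRep8 z` is one of the representatives. [folklore] -/
theorem gaussRep8_mem (z : GaussianInt) : gaussRep8 z ∈ gaussReps8 := by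
  unfold gaussRep8 gaussReps8
  rw [mem_image]
  refine ⟨((z.re % 8).toNat, (z.im % 8).toNat), ?_, ?_⟩
  · rw [mem_product, mem_range, mem_range]
    constructor <;> omega
  · have h1 : (((z.re % 8).toNat : ℕ) : ℤ) = z.re % 8 := Int.toNat_of_nonneg (by omega)
    have h2 : (((z.im % 8).toNat : ℕ) : ℤ) = z.im % 8 := Int.toNat_of_nonneg (by omega)
    ext <;> simp [h1, h2]

/-- `z ≡ gaussRep8 z (mod 8)`. [folklore] -/
theorem gaussCongrEight_gaussRep8 (z : GaussianInt) : GaussCongrEight (gaussRep8 z) z := by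
  unfold GaussCongrEight gaussRep8
  simp only [Zsqrtd.re_sub, Zsqrtd.im_sub]
  constructor
  · rw [Int.emod_def]; exact ⟨z.re / 8, by ring⟩
  · rw [Int.emod_def]; exact ⟨z.im / 8, by ring⟩

/-- A representative congruent to `z` is `gaussRep8 z`. [folklore] -/
theorem eq_gaussRep8_of_mem {z₀ z : GaussianInt} (h₀ : z₀ ∈ gaussReps8) (h : GaussCongrEight z₀ z) :
    z₀ = gaussRep8 z := by
  unfold gaussReps8 at h₀
  obtain ⟨ab, hab, rfl⟩ := mem_image.mp h₀
  rw [mem_product, mem_range, mem_range] at hab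
  obtain ⟨h1, h2⟩ := h
  simp only [Zsqrtd.re_sub, Zsqrtd.im_sub] at h1 h2
  unfold gaussRep8
  ext
  · simp only
    omega
  · simp only
    omega

/-- Exactly one representative class contains `z`: summing an indicator over the representatives
picks out one term. [folklore] -/
theorem sum_gaussReps8_ite {β : Type*} [AddCommMonoid β] (z : GaussianInt) (b : β) :
    (∑ z₀ ∈ gaussReps8, if GaussCongrEight z₀ z then b else 0) = b := by
  rw [sum_eq_single_of_mem (gaussRep8 z) (gaussRep8_mem z)]
  · rw [if_pos (gaussCongrEight_gaussRep8 z)]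
  · intro z₀ h₀ hne
    rw [if_neg]
    intro h
    exact hne (eq_gaussRep8_of_mem h₀ h)

/-- Summing over the classes recovers the unrestricted sum over primary `z`. [folklore] -/
theorem sum_gaussReps8_sum_filter {β : Type*} [AddCommMonoid β] (S : Finset GaussianInt) (g : GaussianInt → β) :
    ∑ z₀ ∈ gaussReps8, ∑ z ∈ S.filter (GaussCongrEight z₀), g z = ∑ z ∈ S, g z := by
  simp_rw [sum_filter]
  rw [sum_comm]
  exact sum_congr rfl fun z _ => sum_gaussReps8_ite z (g z)

/-- **Splitting into classes modulo `8`** ((5.7): "This can be accomplished by splitting `ℬ*(M, N)`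
into … such classes"): the free sector form is the sum over the representatives `z₀` of the class
forms `fiGaussSector … z₀`. [cite: FriedlanderIwaniecAnnals1998, (5.7)] -/
theorem fiFreeSector_eq_sum_fiGaussSector (α : ℕ → ℂ) (q p : ℝ → ℝ) (M N' θ C P τ : ℝ) :
    fiFreeSector α q p M N' θ C P τ = ∑ z₀ ∈ gaussReps8, fiGaussSector α q p z₀ M N' θ C P τ := by
  unfold fiFreeSector fiGaussSector
  rw [sum_comm (s := gaussReps8)]
  refine sum_congr rfl fun m _ => ?_
  rw [sum_comm (s := gaussReps8)]
  refine sum_congr rfl fun n _ => ?_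
  rw [← mul_sum, ← Complex.ofReal_sum]
  congr 2
  rw [sum_comm (s := gaussReps8)]
  refine sum_congr rfl fun uv _ => ?_
  exact (sum_gaussReps8_sum_filter (primaryNormEq n) _).symm

/-! ### Splitting into sectors -/

/-- **Splitting into sectors** ((5.12): "This can be accomplished by splitting according to a smooth
partition of unity (without any residual contribution because there is no boundary)"): with the
periodic partition `Σ_j q_j = 1` of `…AngularPartition`, the free form is the sum of the sector
forms. [cite: FriedlanderIwaniecAnnals1998, (5.12)-(5.13)] -/
theorem fiFreeSector_one_eq_sum_angPiece {θq : ℝ} (hθ : 0 < θq) (hθ1 : θq ≤ 1 / 2) (α : ℕ → ℂ)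
    (p : ℝ → ℝ) (M N' θ C P τ : ℝ) :
    fiFreeSector α (fun _ => 1) p M N' θ C P τ =
      ∑ j ∈ range (angCount θq), fiFreeSector α (angPiece θq j) p M N' θ C P τ := by
  rw [← fiFreeSector_sum]
  congr 1
  funext u
  exact (sum_angPiece hθ hθ1 u).symm

/-! ### Trivial bounds: taking absolute values and swapping to lattice points -/

/-- The `z`-side weight after taking absolute values: `Σ_{z primary, |z|² = n} q(arg z) Σ_{w} 𝔷(Re w̄ z)`
with the `w`-sum over the annulus `wAnnulus`. [folklore] -/
theorem norm_fiFreeSector_le {α : ℕ → ℂ} (hα : ∀ m, ‖α m‖ ≤ 1) {q : ℝ → ℝ} (hq : ∀ u, 0 ≤ q u)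
    (p : ℝ → ℝ) (M N' θ C P τ : ℝ) :
    ‖fiFreeSector α q p M N' θ C P τ‖ ≤
      ∑ n ∈ Ioc ⌊N'⌋₊ ⌊(1 + θ) * N'⌋₊, |fiBeta p C P τ n| *
        ∑ z ∈ primaryNormEq n, q (gaussArg z) *
          ∑ uv ∈ wAnnulus ⌊M⌋₊ ⌊2 * M⌋₊, (fiZeta (uv.1 * z.re + uv.2 * z.im) : ℝ) := by
  unfold fiFreeSector
  -- pointwise bound with `‖α‖ ≤ 1`, then regroup
  have hinner : ∀ m n, 0 ≤ ∑ uv ∈ sqPairs m, ∑ z ∈ primaryNormEq n,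
      q (gaussArg z) * (fiZeta (star (toGauss uv) * z).re : ℝ) := fun m n =>
    sum_nonneg fun uv _ => sum_nonneg fun z _ => mul_nonneg (hq _) (Nat.cast_nonneg _)
  calc ‖∑ m ∈ Ioc ⌊M⌋₊ ⌊2 * M⌋₊, ∑ n ∈ Ioc ⌊N'⌋₊ ⌊(1 + θ) * N'⌋₊,
        α m * ((fiBeta p C P τ n : ℝ) : ℂ) *
          ((∑ uv ∈ sqPairs m, ∑ z ∈ primaryNormEq n,
              q (gaussArg z) * (fiZeta (star (toGauss uv) * z).re : ℝ) : ℝ) : ℂ)‖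
      ≤ ∑ m ∈ Ioc ⌊M⌋₊ ⌊2 * M⌋₊, ∑ n ∈ Ioc ⌊N'⌋₊ ⌊(1 + θ) * N'⌋₊,
          |fiBeta p C P τ n| * ∑ uv ∈ sqPairs m, ∑ z ∈ primaryNormEq n,
              q (gaussArg z) * (fiZeta (star (toGauss uv) * z).re : ℝ) := by
        refine (norm_sum_le _ _).trans (sum_le_sum fun m _ => ?_)
        refine (norm_sum_le _ _).trans (sum_le_sum fun n _ => ?_)
        set S := (∑ uv ∈ sqPairs m, ∑ z ∈ primaryNormEq n,
          q (gaussArg z) * (fiZeta (star (toGauss uv) * z).re : ℝ)) with hS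
        have hS0 : 0 ≤ S := hinner m n
        rw [norm_mul, norm_mul, Complex.norm_real, Complex.norm_real, Real.norm_eq_abs,
          Real.norm_eq_abs, abs_of_nonneg hS0]
        have hb : 0 ≤ |fiBeta p C P τ n| * S := mul_nonneg (abs_nonneg _) hS0
        calc ‖α m‖ * |fiBeta p C P τ n| * S = ‖α m‖ * (|fiBeta p C P τ n| * S) := by ring
          _ ≤ 1 * (|fiBeta p C P τ n| * S) := mul_le_mul_of_nonneg_right (hα m) hb
          _ = |fiBeta p C P τ n| * S := one_mul _
    _ = ∑ n ∈ Ioc ⌊N'⌋₊ ⌊(1 + θ) * N'⌋₊, |fiBeta p C P τ n| *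
          ∑ m ∈ Ioc ⌊M⌋₊ ⌊2 * M⌋₊, ∑ uv ∈ sqPairs m, ∑ z ∈ primaryNormEq n,
              q (gaussArg z) * (fiZeta (star (toGauss uv) * z).re : ℝ) := by
        rw [sum_comm]
        refine sum_congr rfl fun n _ => ?_
        rw [mul_sum]
    _ = _ := by
        refine sum_congr rfl fun n _ => ?_
        congr 1
        rw [sum_Ioc_sum_sqPairs, sum_comm]
        refine sum_congr rfl fun z _ => ?_
        rw [mul_sum]
        refine sum_congr rfl fun uv _ => ?_
        rw [re_star_toGauss_mul]

/-- The same for the complementary form: `‖ℬ̃(M, N)‖ ≤ Σ_n |β(n)| Σ_{z primary, |z|²=n} Σ_{w, (|w|², n) ≠ 1} 𝔷(Re w̄ z)`.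
[cite: FriedlanderIwaniecAnnals1998, §5, proof of (5.10)] -/
theorem norm_fiGaussCompl_le {α : ℕ → ℂ} (hα : ∀ m, ‖α m‖ ≤ 1) (p : ℝ → ℝ) (M N' θ C P τ : ℝ) :
    ‖fiGaussCompl α p M N' θ C P τ‖ ≤
      ∑ n ∈ Ioc ⌊N'⌋₊ ⌊(1 + θ) * N'⌋₊, |fiBeta p C P τ n| *
        ∑ z ∈ primaryNormEq n,
          ∑ uv ∈ (wAnnulus ⌊M⌋₊ ⌊2 * M⌋₊).filter
              (fun uv => ¬ n.Coprime (uv.1 ^ 2 + uv.2 ^ 2).toNat),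
            (fiZeta (uv.1 * z.re + uv.2 * z.im) : ℝ) := by
  unfold fiGaussCompl
  -- pointwise bound, written with an indicator of the coprimality condition
  set I := Ioc ⌊N'⌋₊ ⌊(1 + θ) * N'⌋₊ with hI
  have h1 : ‖∑ m ∈ Ioc ⌊M⌋₊ ⌊2 * M⌋₊, ∑ n ∈ I.filter (fun n : ℕ => ¬ n.Coprime m),
      α m * ((fiBeta p C P τ n : ℝ) : ℂ) *
        ((∑ uv ∈ sqPairs m, ∑ z ∈ primaryNormEq n, fiZeta (star (toGauss uv) * z).re : ℕ) : ℂ)‖ ≤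
      ∑ m ∈ Ioc ⌊M⌋₊ ⌊2 * M⌋₊, ∑ n ∈ I, |fiBeta p C P τ n| *
        ∑ uv ∈ sqPairs m, ∑ z ∈ primaryNormEq n,
          if ¬ n.Coprime m then (fiZeta (uv.1 * z.re + uv.2 * z.im) : ℝ) else 0 := by
    refine (norm_sum_le _ _).trans (sum_le_sum fun m _ => ?_)
    refine (norm_sum_le _ _).trans ?_
    rw [← sum_filter_add_sum_filter_not I (fun n : ℕ => ¬ n.Coprime m)]
    have hz : ∑ n ∈ I.filter (fun n : ℕ => ¬¬ n.Coprime m), |fiBeta p C P τ n| *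
        ∑ uv ∈ sqPairs m, ∑ z ∈ primaryNormEq n,
          (if ¬ n.Coprime m then (fiZeta (uv.1 * z.re + uv.2 * z.im) : ℝ) else 0) = 0 := by
      refine sum_eq_zero fun n hn => ?_
      have h : n.Coprime m := by simpa using (mem_filter.mp hn).2
      simp [h]
    rw [hz, add_zero]
    refine sum_le_sum fun n hn => ?_
    have h : ¬ n.Coprime m := (mem_filter.mp hn).2
    simp only [h, not_false_eq_true, if_true]
    rw [norm_mul, norm_mul, Complex.norm_real, Real.norm_eq_abs, Complex.norm_natCast]
    push_cast
    simp only [re_star_toGauss_mul]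
    set S := (∑ uv ∈ sqPairs m, ∑ z ∈ primaryNormEq n, (fiZeta (uv.1 * z.re + uv.2 * z.im) : ℝ)) with hS
    have hS0 : 0 ≤ S := sum_nonneg fun uv _ => sum_nonneg fun z _ => Nat.cast_nonneg _
    have hb : 0 ≤ |fiBeta p C P τ n| * S := mul_nonneg (abs_nonneg _) hS0
    calc ‖α m‖ * |fiBeta p C P τ n| * S = ‖α m‖ * (|fiBeta p C P τ n| * S) := by ring
      _ ≤ 1 * (|fiBeta p C P τ n| * S) := mul_le_mul_of_nonneg_right (hα m) hb
      _ = |fiBeta p C P τ n| * S := one_mul _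
  refine h1.trans (le_of_eq ?_)
  rw [sum_comm]
  refine sum_congr rfl fun n _ => ?_
  rw [← mul_sum]
  congr 1
  -- regroup `Σ_m Σ_{uv ∈ sqPairs m}` as `Σ_{uv ∈ wAnnulus}`, the condition becoming one on `|w|²`
  have e : ∀ m ∈ Ioc ⌊M⌋₊ ⌊2 * M⌋₊, ∑ uv ∈ sqPairs m, ∑ z ∈ primaryNormEq n,
      (if ¬ n.Coprime m then (fiZeta (uv.1 * z.re + uv.2 * z.im) : ℝ) else 0) =
      ∑ uv ∈ sqPairs m, ∑ z ∈ primaryNormEq n,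
        (if ¬ n.Coprime (uv.1 ^ 2 + uv.2 ^ 2).toNat then (fiZeta (uv.1 * z.re + uv.2 * z.im) : ℝ)
          else 0) := by
    intro m _
    refine sum_congr rfl fun uv huv => ?_
    have hm : (uv.1 ^ 2 + uv.2 ^ 2).toNat = m := by
      rw [mem_sqPairs.mp huv, Int.toNat_natCast]
    rw [hm]
  rw [sum_congr rfl e, sum_Ioc_sum_sqPairs, sum_comm]
  refine sum_congr rfl fun z _ => ?_
  rw [sum_filter]


/-! ## Part 3: the bounds -/

/-! ### Small real-analysis helpers -/

/-- `⌊√⌊√b⌋⌋ ≤ b^{1/4}`. [folklore] -/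
theorem natSqrt_natSqrt_le_rpow (b : ℕ) : (Nat.sqrt (Nat.sqrt b) : ℝ) ≤ (b : ℝ) ^ (1 / 4 : ℝ) := by
  set s := Nat.sqrt (Nat.sqrt b) with hs
  have h1 : s ^ 2 ≤ Nat.sqrt b := Nat.sqrt_le' _
  have h2 : (Nat.sqrt b) ^ 2 ≤ b := Nat.sqrt_le' _
  have h3 : (s ^ 2) ^ 2 ≤ (Nat.sqrt b) ^ 2 := Nat.pow_le_pow_left h1 2
  have h4 : s ^ 4 ≤ b := by
    calc s ^ 4 = (s ^ 2) ^ 2 := by ring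
      _ ≤ b := h3.trans h2
  have h4r : ((s : ℝ)) ^ (4 : ℕ) ≤ (b : ℝ) := by exact_mod_cast h4
  have hs0 : (0 : ℝ) ≤ s := Nat.cast_nonneg _
  calc (s : ℝ) = ((s : ℝ) ^ (4 : ℕ)) ^ ((4 : ℕ) : ℝ)⁻¹ := (Real.pow_rpow_inv_natCast hs0 (by norm_num)).symm
    _ ≤ (b : ℝ) ^ ((4 : ℕ) : ℝ)⁻¹ := Real.rpow_le_rpow (by positivity) h4r (by positivity)
    _ = (b : ℝ) ^ (1 / 4 : ℝ) := by norm_num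

/-- Natural division bounded by real division with a smaller positive denominator. [folklore] -/
theorem natCast_div_le_div {a b : ℕ} {c : ℝ} (hc : 0 < c) (hcb : c ≤ b) :
    ((a / b : ℕ) : ℝ) ≤ (a : ℝ) / c := by
  have hb : (0 : ℝ) < b := hc.trans_le hcb
  calc ((a / b : ℕ) : ℝ) ≤ (a : ℝ) / b := Nat.cast_div_le
    _ ≤ (a : ℝ) / c := div_le_div_of_nonneg_left (Nat.cast_nonneg _) hc hcb

/-- What `β(n) ≠ 0` entails: `n` squarefree, all prime factors `≥ P`, `τ(n) ≤ τ` ((4.13), (4.21),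
(4.22)). [cite: FriedlanderIwaniecAnnals1998, (4.13) with (4.21)-(4.22)] -/
theorem of_fiBeta_ne_zero {p : ℝ → ℝ} {C P τ : ℝ} {n : ℕ} (h : fiBeta p C P τ n ≠ 0) :
    Squarefree n ∧ (∀ q ∈ n.primeFactors, P ≤ (q : ℝ)) ∧ ((#n.divisors : ℕ) : ℝ) ≤ τ := by
  unfold fiBeta at h
  split_ifs at h with hc
  · have hμ : (ArithmeticFunction.moebius n : ℝ) ≠ 0 := by
      intro h0; apply h; rw [h0]; ring
    have hμ' : ArithmeticFunction.moebius n ≠ 0 := by exact_mod_cast hμ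
    refine ⟨ArithmeticFunction.moebius_ne_zero_iff_squarefree.mp hμ', hc.1, ?_⟩
    rw [← ArithmeticFunction.sigma_zero_apply]; exact hc.2
  · exact absurd rfl h

/-! ### The inner sum `Σ_w 𝔷(Re w̄ z)` for primitive `z` in the annulus -/

/-- **`Σ_{M<|w|²≤2M} 𝔷(Re w̄ z) ≪ M^{3/4}N^{-1/4}`**, explicit: for squarefree `n = |z|²` with
`Y₁ < n ≤ Y₂`, `Y₁ ≥ 1`,
`Σ_{w ∈ wAnnulus X₁ X₂} 𝔷(u r + v s) ≤ (2(X₂Y₂)^{1/4} + 1)(2√X₂/√(Y₁/2) + 1)`.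
[cite: FriedlanderIwaniecAnnals1998, §5, proof of (5.16)] -/
theorem inner_sum_fiZeta_le {X₁ X₂ Y₁ Y₂ n : ℕ} (hY₁ : 0 < Y₁) (hn : Y₁ < n) (hnY : n ≤ Y₂)
    (hsq : Squarefree n) {z : GaussianInt} (hz : z.norm = n) :
    (∑ uv ∈ wAnnulus X₁ X₂, (fiZeta (uv.1 * z.re + uv.2 * z.im) : ℝ)) ≤
      (2 * ((X₂ : ℝ) * Y₂) ^ (1 / 4 : ℝ) + 1) * (2 * Real.sqrt X₂ / Real.sqrt (Y₁ / 2) + 1) := by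
  have hn0 : 0 < n := by omega
  have hrs : z.re ^ 2 + z.im ^ 2 = (n : ℤ) := by rw [← hz, Zsqrtd.norm_def]; ring
  have hcop := isCoprime_re_im_of_squarefree hz hsq
  have h := sum_fiZeta_line_le (S := wAnnulus X₁ X₂) (X := X₂)
    (fun uv huv => sq_add_sq_le_of_mem_wAnnulus huv) hrs hcop hn0
  set s := Nat.sqrt (Nat.sqrt (X₂ * n)) with hs
  set mx := max z.re.natAbs z.im.natAbs with hmx
  -- the two factors
  have hsle : (s : ℝ) ≤ ((X₂ : ℝ) * Y₂) ^ (1 / 4 : ℝ) := by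
    refine (natSqrt_natSqrt_le_rpow (X₂ * n)).trans ?_
    refine Real.rpow_le_rpow (by positivity) ?_ (by norm_num)
    have : X₂ * n ≤ X₂ * Y₂ := Nat.mul_le_mul_left _ hnY
    exact_mod_cast this
  have hmx2 : (Y₁ : ℝ) / 2 ≤ (mx : ℝ) ^ 2 := by
    have h1 := le_two_mul_max_natAbs_sq hz
    rw [← hmx] at h1
    have h1' : (n : ℝ) ≤ 2 * (mx : ℝ) ^ 2 := by exact_mod_cast h1
    have h2 : (Y₁ : ℝ) ≤ n := by exact_mod_cast hn.le
    linarith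
  have hq0 : 0 < Real.sqrt (Y₁ / 2) := Real.sqrt_pos.mpr (by positivity)
  have hmxge : Real.sqrt (Y₁ / 2) ≤ mx := by
    calc Real.sqrt (Y₁ / 2) ≤ Real.sqrt ((mx : ℝ) ^ 2) := Real.sqrt_le_sqrt hmx2
      _ = mx := Real.sqrt_sq (Nat.cast_nonneg _)
  have hdiv : ((2 * Nat.sqrt X₂ / mx : ℕ) : ℝ) ≤ 2 * Real.sqrt X₂ / Real.sqrt (Y₁ / 2) := by
    refine (natCast_div_le_div hq0 hmxge).trans ?_
    gcongr
    push_cast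
    exact mul_le_mul_of_nonneg_left Real.nat_sqrt_le_real_sqrt (by norm_num)
  calc (∑ uv ∈ wAnnulus X₁ X₂, (fiZeta (uv.1 * z.re + uv.2 * z.im) : ℝ))
      = ((∑ uv ∈ wAnnulus X₁ X₂, fiZeta (uv.1 * z.re + uv.2 * z.im) : ℕ) : ℝ) := by push_cast; rfl
    _ ≤ (((2 * s + 1) * (2 * Nat.sqrt X₂ / mx + 1) : ℕ) : ℝ) := by exact_mod_cast h
    _ = (2 * (s : ℝ) + 1) * (((2 * Nat.sqrt X₂ / mx : ℕ) : ℝ) + 1) := by push_cast; ring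
    _ ≤ (2 * ((X₂ : ℝ) * Y₂) ^ (1 / 4 : ℝ) + 1) * (2 * Real.sqrt X₂ / Real.sqrt (Y₁ / 2) + 1) := by
        gcongr

/-! ### The near-axis ("bad sectors") bound -/

/-- **The trivial bound for the near-axis sectors, explicit form.** Let `0 ≤ q ≤ 1` be an angular
weight such that `q(arg z) ≠ 0` (for primary `z` with `N' < |z|² ≤ (1+θ)N'`) forces
`|re z| ≤ W` or `|im z| ≤ W`; let `|p| ≤ 1`, `|α| ≤ 1`, `Y₁ = ⌊N'⌋ ≥ 1`, `2W² ≤ Y₁`, and `D ≥ d`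
whenever `d³ ≤ Y₂ = ⌊(1+θ)N'⌋`. Then
`‖ℬ_q(M, N)‖ ≤ (2(X₂Y₂)^{1/4} + 1)(2√X₂/√(Y₁/2) + 1) · 18(2W+1)(1 + log D)⁴(2(Y₂-Y₁)/√(2Y₁) + 5D)`,
`X₂ = ⌊2M⌋` (the inner `w`-count times the near-axis divisor sum).
[cite: FriedlanderIwaniecAnnals1998, §5, (5.16) and "the other sectors, altogether of angle `≤ 2πϑ`,
contribute no more than the bound (4.23) by the estimate (5.16)"] -/
theorem norm_fiFreeSector_nearAxis_le {α : ℕ → ℂ} (hα : ∀ m, ‖α m‖ ≤ 1)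
    {q : ℝ → ℝ} (hq0 : ∀ u, 0 ≤ q u) (hq1 : ∀ u, q u ≤ 1)
    {p : ℝ → ℝ} (hp : ∀ u, |p u| ≤ 1) {M N' θ C P τ : ℝ} {W : ℕ}
    (hqW : ∀ n ∈ Ioc ⌊N'⌋₊ ⌊(1 + θ) * N'⌋₊, ∀ z ∈ primaryNormEq n,
        q (gaussArg z) ≠ 0 → z.re.natAbs ≤ W ∨ z.im.natAbs ≤ W)
    (hY₁ : 0 < ⌊N'⌋₊) (hY : ⌊N'⌋₊ ≤ ⌊(1 + θ) * N'⌋₊) (hW2 : 2 * W ^ 2 ≤ ⌊N'⌋₊) {D : ℕ}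
    (hD : ∀ d : ℕ, 0 < d → d ^ 3 ≤ ⌊(1 + θ) * N'⌋₊ → d ≤ D) :
    ‖fiFreeSector α q p M N' θ C P τ‖ ≤
      ((2 * ((⌊2 * M⌋₊ : ℝ) * ⌊(1 + θ) * N'⌋₊) ^ (1 / 4 : ℝ) + 1) *
          (2 * Real.sqrt ⌊2 * M⌋₊ / Real.sqrt (⌊N'⌋₊ / 2) + 1)) *
        (18 * (2 * W + 1) * (1 + Real.log D) ^ 4 *
          (2 * ((⌊(1 + θ) * N'⌋₊ : ℝ) - ⌊N'⌋₊) / Real.sqrt (2 * ⌊N'⌋₊) + 5 * D)) := by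
  set Y₁ := ⌊N'⌋₊ with hY₁def
  set Y₂ := ⌊(1 + θ) * N'⌋₊ with hY₂def
  set X₂ := ⌊2 * M⌋₊ with hX₂def
  set InB : ℝ := (2 * ((X₂ : ℝ) * Y₂) ^ (1 / 4 : ℝ) + 1) *
    (2 * Real.sqrt X₂ / Real.sqrt (Y₁ / 2) + 1) with hInB
  have hInB0 : 0 ≤ InB := by
    have : 0 ≤ 2 * Real.sqrt X₂ / Real.sqrt (Y₁ / 2) := by positivity
    rw [hInB]; positivity
  set near : ℤ × ℤ → Prop := fun rs => rs.1.natAbs ≤ W ∨ rs.2.natAbs ≤ W with hnear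
  -- Step 1: absolute values
  refine (norm_fiFreeSector_le hα hq0 p M N' θ C P τ).trans ?_
  -- Step 2: the summand for each `n`
  have hstep : ∀ n ∈ Ioc Y₁ Y₂, |fiBeta p C P τ n| *
      ∑ z ∈ primaryNormEq n, q (gaussArg z) *
        ∑ uv ∈ wAnnulus ⌊M⌋₊ X₂, (fiZeta (uv.1 * z.re + uv.2 * z.im) : ℝ) ≤
      InB * ((if Squarefree n then (#n.divisors : ℝ) else 0) *
        #((primaryNormEq n).filter fun z => near (z.re, z.im))) := by
    intro n hn
    obtain ⟨hn1, hn2⟩ := mem_Ioc.mp hn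
    by_cases hb : fiBeta p C P τ n = 0
    · rw [hb, abs_zero, zero_mul]
      refine mul_nonneg hInB0 (mul_nonneg ?_ (Nat.cast_nonneg _))
      split_ifs <;> simp
    obtain ⟨hsq, -, -⟩ := of_fiBeta_ne_zero hb
    rw [if_pos hsq]
    have hβ : |fiBeta p C P τ n| ≤ #n.divisors := abs_fiBeta_le_card_divisors hp C P τ n
    -- inner sums
    have hz : ∀ z ∈ primaryNormEq n, q (gaussArg z) *
        ∑ uv ∈ wAnnulus ⌊M⌋₊ X₂, (fiZeta (uv.1 * z.re + uv.2 * z.im) : ℝ) ≤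
        if near (z.re, z.im) then InB else 0 := by
      intro z hzmem
      obtain ⟨hzn, -⟩ := mem_primaryNormEq.mp hzmem
      by_cases hqz : q (gaussArg z) = 0
      · rw [hqz, zero_mul]; split_ifs <;> [exact hInB0; exact le_rfl]
      have hnr : near (z.re, z.im) := hqW n hn z hzmem hqz
      rw [if_pos hnr]
      have hin := inner_sum_fiZeta_le (X₁ := ⌊M⌋₊) (X₂ := X₂) hY₁ hn1 hn2 hsq hzn
      have hin0 : 0 ≤ ∑ uv ∈ wAnnulus ⌊M⌋₊ X₂, (fiZeta (uv.1 * z.re + uv.2 * z.im) : ℝ) :=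
        sum_nonneg fun _ _ => Nat.cast_nonneg _
      calc q (gaussArg z) * _ ≤ 1 * _ := mul_le_mul_of_nonneg_right (hq1 _) hin0
        _ ≤ InB := by rw [one_mul]; exact hin
    have hsumz : ∑ z ∈ primaryNormEq n, q (gaussArg z) *
        ∑ uv ∈ wAnnulus ⌊M⌋₊ X₂, (fiZeta (uv.1 * z.re + uv.2 * z.im) : ℝ) ≤
        InB * #((primaryNormEq n).filter fun z => near (z.re, z.im)) := by
      refine (sum_le_sum hz).trans (le_of_eq ?_)
      rw [← sum_filter, sum_const, nsmul_eq_mul, mul_comm]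
    have hsum0 : 0 ≤ ∑ z ∈ primaryNormEq n, q (gaussArg z) *
        ∑ uv ∈ wAnnulus ⌊M⌋₊ X₂, (fiZeta (uv.1 * z.re + uv.2 * z.im) : ℝ) :=
      sum_nonneg fun z _ => mul_nonneg (hq0 _) (sum_nonneg fun _ _ => Nat.cast_nonneg _)
    calc |fiBeta p C P τ n| * _ ≤ (#n.divisors : ℝ) * (InB * #((primaryNormEq n).filter
          fun z => near (z.re, z.im))) := mul_le_mul hβ hsumz hsum0 (Nat.cast_nonneg _)
      _ = _ := by ring
  refine (sum_le_sum hstep).trans ?_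
  rw [← mul_sum]
  refine mul_le_mul_of_nonneg_left ?_ hInB0
  -- Step 3: to lattice points, then the near-axis divisor sum
  have e : ∑ n ∈ Ioc Y₁ Y₂, (if Squarefree n then (#n.divisors : ℝ) else 0) *
      #((primaryNormEq n).filter fun z => near (z.re, z.im)) =
      ∑ n ∈ (Ioc Y₁ Y₂).filter Squarefree, (#n.divisors : ℝ) *
        #((primaryNormEq n).filter fun z => near (z.re, z.im)) := by
    rw [sum_filter]
    refine sum_congr rfl fun n _ => ?_
    split_ifs <;> simp
  rw [e]
  refine (sum_card_primary_filter_le (Y₁ := Y₁) (Y₂ := Y₂) near).trans ?_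
  have eset : ((Icc (-(Y₂ : ℤ)) Y₂) ×ˢ (Icc (-(Y₂ : ℤ)) Y₂)).filter (fun z =>
      near z ∧ (Y₁ : ℤ) < z.1 ^ 2 + z.2 ^ 2 ∧ z.1 ^ 2 + z.2 ^ 2 ≤ (Y₂ : ℤ) ∧
        Squarefree (z.1 ^ 2 + z.2 ^ 2).toNat) =
      (nearAxisSet W Y₁ Y₂).filter (fun z => Squarefree (z.1 ^ 2 + z.2 ^ 2).toNat) := by
    rw [nearAxisSet, filter_filter]
    refine filter_congr fun z _ => ?_
    simp only [hnear]
    tauto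
  rw [eset]
  exact sum_nearAxis_tau_le hY hY₁ hW2 hD

/-! ### The complementary form (5.10) -/

/-- Covering the `w` with `(|w|², n) ≠ 1` by the primes `r ∣ n`: for nonnegative `g`,
`Σ_{w : (|w|², n) ≠ 1} g(w) ≤ Σ_{r ∣ n prime} Σ_{w : r ∣ |w|²} g(w)`. [folklore] -/
theorem sum_filter_not_coprime_le (S : Finset (ℤ × ℤ)) {n : ℕ} (hn0 : 0 < n) {g : ℤ × ℤ → ℝ}
    (hg0 : ∀ uv, 0 ≤ g uv) :
    ∑ uv ∈ S.filter (fun uv => ¬ n.Coprime (uv.1 ^ 2 + uv.2 ^ 2).toNat), g uv ≤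
      ∑ r ∈ n.primeFactors, ∑ uv ∈ S.filter (fun uv => (r : ℤ) ∣ uv.1 ^ 2 + uv.2 ^ 2), g uv := by
  have h1 : ∀ uv ∈ S.filter (fun uv => ¬ n.Coprime (uv.1 ^ 2 + uv.2 ^ 2).toNat),
      g uv ≤ ∑ r ∈ n.primeFactors, if (r : ℤ) ∣ uv.1 ^ 2 + uv.2 ^ 2 then g uv else 0 := by
    intro uv huv
    obtain ⟨-, hnc⟩ := mem_filter.mp huv
    obtain ⟨r, hr, hrn, hrm⟩ := Nat.Prime.not_coprime_iff_dvd.mp hnc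
    have hrmem : r ∈ n.primeFactors := Nat.mem_primeFactors.mpr ⟨hr, hrn, hn0.ne'⟩
    have hrz : (r : ℤ) ∣ uv.1 ^ 2 + uv.2 ^ 2 := by
      have h0 : 0 ≤ uv.1 ^ 2 + uv.2 ^ 2 := by positivity
      rw [← Int.toNat_of_nonneg h0]; exact Int.natCast_dvd_natCast.mpr hrm
    have hterm : ∀ r' ∈ n.primeFactors, 0 ≤ (if ((r' : ℕ) : ℤ) ∣ uv.1 ^ 2 + uv.2 ^ 2 then g uv else 0) := by
      intro r' _
      split_ifs
      · exact hg0 uv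
      · exact le_rfl
    calc g uv = if (r : ℤ) ∣ uv.1 ^ 2 + uv.2 ^ 2 then g uv else 0 := by rw [if_pos hrz]
      _ ≤ ∑ r' ∈ n.primeFactors, if ((r' : ℕ) : ℤ) ∣ uv.1 ^ 2 + uv.2 ^ 2 then g uv else 0 :=
          single_le_sum (f := fun r' : ℕ => if ((r' : ℕ) : ℤ) ∣ uv.1 ^ 2 + uv.2 ^ 2 then g uv else 0)
            hterm hrmem
  calc _ ≤ ∑ uv ∈ S.filter (fun uv => ¬ n.Coprime (uv.1 ^ 2 + uv.2 ^ 2).toNat),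
        ∑ r ∈ n.primeFactors, (if (r : ℤ) ∣ uv.1 ^ 2 + uv.2 ^ 2 then g uv else 0) := sum_le_sum h1
    _ ≤ ∑ uv ∈ S, ∑ r ∈ n.primeFactors, (if (r : ℤ) ∣ uv.1 ^ 2 + uv.2 ^ 2 then g uv else 0) := by
        refine sum_le_sum_of_subset_of_nonneg (filter_subset _ _) fun uv _ _ => sum_nonneg fun r _ => ?_
        split_ifs
        · exact hg0 uv
        · exact le_rfl
    _ = _ := by
        rw [sum_comm]
        refine sum_congr rfl fun r _ => ?_
        rw [sum_filter]

/-- The count for one prime `r ≥ P`, `r ∣ n = |z|²`, in real form: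
`Σ_{w ∈ wAnnulus, r ∣ |w|²} 𝔷(Re w̄ z) ≤ (2T₀ + 1)(2√X₂/(P q₀) + 1) + (2T₀/P + 1)(2√X₂/q₀ + 1)`,
`T₀ = (X₂Y₂)^{1/4}`, `q₀ = √(Y₁/2)`. [cite: FriedlanderIwaniecAnnals1998, §5, proof of (5.10)] -/
theorem sum_filter_dvd_fiZeta_le {X₁ X₂ Y₁ Y₂ n : ℕ} (hY₁ : 0 < Y₁) (hn : Y₁ < n) (hnY : n ≤ Y₂)
    (hsq : Squarefree n) {z : GaussianInt} (hz : z.norm = n) {r : ℕ} (hrp : r.Prime) (hrn : r ∣ n)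
    {P : ℝ} (hP : 2 < P) (hrP : P ≤ (r : ℝ)) :
    (∑ uv ∈ (wAnnulus X₁ X₂).filter (fun uv => (r : ℤ) ∣ uv.1 ^ 2 + uv.2 ^ 2),
        (fiZeta (uv.1 * z.re + uv.2 * z.im) : ℝ)) ≤
      (2 * ((X₂ : ℝ) * Y₂) ^ (1 / 4 : ℝ) + 1) *
          (2 * Real.sqrt X₂ / (P * Real.sqrt (Y₁ / 2)) + 1) +
        (2 * ((X₂ : ℝ) * Y₂) ^ (1 / 4 : ℝ) / P + 1) * (2 * Real.sqrt X₂ / Real.sqrt (Y₁ / 2) + 1) := by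
  have hn0 : 0 < n := by omega
  have hP0 : 0 < P := by linarith
  have hrs : z.re ^ 2 + z.im ^ 2 = (n : ℤ) := by rw [← hz, Zsqrtd.norm_def]; ring
  have hcop := isCoprime_re_im_of_squarefree hz hsq
  have hr2 : r ≠ 2 := by
    rintro rfl; norm_num at hrP; linarith
  have hr0 : (0 : ℝ) < r := by exact_mod_cast hrp.pos
  have h := sum_fiZeta_line_dvd_le (S := wAnnulus X₁ X₂) (X := X₂)
    (fun uv huv => sq_add_sq_le_of_mem_wAnnulus huv) hrs hcop hn0 hrp hr2 hrn
  have hq0 : 0 < Real.sqrt (Y₁ / 2) := Real.sqrt_pos.mpr (by positivity)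
  -- the factors
  have hsle : (Nat.sqrt (Nat.sqrt (X₂ * n)) : ℝ) ≤ ((X₂ : ℝ) * Y₂) ^ (1 / 4 : ℝ) := by
    refine (natSqrt_natSqrt_le_rpow (X₂ * n)).trans ?_
    refine Real.rpow_le_rpow (by positivity) ?_ (by norm_num)
    have : X₂ * n ≤ X₂ * Y₂ := Nat.mul_le_mul_left _ hnY
    exact_mod_cast this
  have hmx2 : (Y₁ : ℝ) / 2 ≤ ((max z.re.natAbs z.im.natAbs : ℕ) : ℝ) ^ 2 := by
    have h1 := le_two_mul_max_natAbs_sq hz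
    have h1' : (n : ℝ) ≤ 2 * ((max z.re.natAbs z.im.natAbs : ℕ) : ℝ) ^ 2 := by exact_mod_cast h1
    have h2 : (Y₁ : ℝ) ≤ n := by exact_mod_cast hn.le
    linarith
  have hmxge : Real.sqrt (Y₁ / 2) ≤ ((max z.re.natAbs z.im.natAbs : ℕ) : ℝ) := by
    calc Real.sqrt (Y₁ / 2) ≤ Real.sqrt (((max z.re.natAbs z.im.natAbs : ℕ) : ℝ) ^ 2) :=
          Real.sqrt_le_sqrt hmx2
      _ = _ := Real.sqrt_sq (Nat.cast_nonneg _)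
  have hsqrt : (Nat.sqrt X₂ : ℝ) ≤ Real.sqrt X₂ := Real.nat_sqrt_le_real_sqrt
  have hdiv1 : ((2 * Nat.sqrt X₂ / (r * max z.re.natAbs z.im.natAbs) : ℕ) : ℝ) ≤
      2 * Real.sqrt X₂ / (P * Real.sqrt (Y₁ / 2)) := by
    have hPq : P * Real.sqrt (Y₁ / 2) ≤ ((r * max z.re.natAbs z.im.natAbs : ℕ) : ℝ) := by
      rw [Nat.cast_mul]
      exact mul_le_mul hrP hmxge hq0.le hr0.le
    refine (natCast_div_le_div (by positivity) hPq).trans ?_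
    gcongr; push_cast; linarith
  have hdiv2 : ((2 * Nat.sqrt X₂ / max z.re.natAbs z.im.natAbs : ℕ) : ℝ) ≤
      2 * Real.sqrt X₂ / Real.sqrt (Y₁ / 2) := by
    refine (natCast_div_le_div hq0 hmxge).trans ?_
    gcongr; push_cast; linarith
  have hdiv3 : ((2 * Nat.sqrt (Nat.sqrt (X₂ * n)) / r : ℕ) : ℝ) ≤
      2 * ((X₂ : ℝ) * Y₂) ^ (1 / 4 : ℝ) / P := by
    refine (natCast_div_le_div hP0 hrP).trans ?_
    gcongr; push_cast; linarith
  have hcast : (∑ uv ∈ (wAnnulus X₁ X₂).filter (fun uv => (r : ℤ) ∣ uv.1 ^ 2 + uv.2 ^ 2),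
      (fiZeta (uv.1 * z.re + uv.2 * z.im) : ℝ)) =
      ((∑ uv ∈ (wAnnulus X₁ X₂).filter (fun uv => (r : ℤ) ∣ uv.1 ^ 2 + uv.2 ^ 2),
        fiZeta (uv.1 * z.re + uv.2 * z.im) : ℕ) : ℝ) := by push_cast; rfl
  rw [hcast]
  refine (Nat.cast_le.mpr h).trans ?_
  push_cast
  gcongr

/-- **The complementary form, explicit form** (proof of (5.10)): for `P > 2`, `|p| ≤ 1`, `|α| ≤ 1`,
`1 ≤ Y₁ = ⌊N'⌋`, `Y₂ = ⌊(1+θ)N'⌋`: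
`‖ℬ̃(M, N)‖ ≤ τ² (2√Y₂ + 1)² [(2T₀ + 1)(2√X₂/(P q₀) + 1) + (2T₀/P + 1)(2√X₂/q₀ + 1)]`
with `T₀ = (X₂Y₂)^{1/4}`, `q₀ = √(Y₁/2)`, `X₂ = ⌊2M⌋` (here `τ` is the cap (4.22) on `τ(n)`, which
also bounds `|β(n)|` and the number of primes dividing `n`).
[cite: FriedlanderIwaniecAnnals1998, §5, proof of (5.10)] -/
theorem norm_fiGaussCompl_le_explicit {α : ℕ → ℂ} (hα : ∀ m, ‖α m‖ ≤ 1)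
    {p : ℝ → ℝ} (hp : ∀ u, |p u| ≤ 1) {M N' θ C P τ : ℝ} (hP : 2 < P) (hτ : 0 ≤ τ)
    (hY₁ : 0 < ⌊N'⌋₊) :
    ‖fiGaussCompl α p M N' θ C P τ‖ ≤
      τ ^ 2 * (2 * Real.sqrt ⌊(1 + θ) * N'⌋₊ + 1) ^ 2 *
        ((2 * ((⌊2 * M⌋₊ : ℝ) * ⌊(1 + θ) * N'⌋₊) ^ (1 / 4 : ℝ) + 1) *
            (2 * Real.sqrt ⌊2 * M⌋₊ / (P * Real.sqrt (⌊N'⌋₊ / 2)) + 1) +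
          (2 * ((⌊2 * M⌋₊ : ℝ) * ⌊(1 + θ) * N'⌋₊) ^ (1 / 4 : ℝ) / P + 1) *
            (2 * Real.sqrt ⌊2 * M⌋₊ / Real.sqrt (⌊N'⌋₊ / 2) + 1)) := by
  -- abbreviate the constant
  obtain ⟨CB, hCBdef⟩ : ∃ CB : ℝ, CB =
      (2 * ((⌊2 * M⌋₊ : ℝ) * ⌊(1 + θ) * N'⌋₊) ^ (1 / 4 : ℝ) + 1) *
          (2 * Real.sqrt ⌊2 * M⌋₊ / (P * Real.sqrt (⌊N'⌋₊ / 2)) + 1) +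
        (2 * ((⌊2 * M⌋₊ : ℝ) * ⌊(1 + θ) * N'⌋₊) ^ (1 / 4 : ℝ) / P + 1) *
          (2 * Real.sqrt ⌊2 * M⌋₊ / Real.sqrt (⌊N'⌋₊ / 2) + 1) := ⟨_, rfl⟩
  rw [← hCBdef]
  have hP0 : 0 < P := by linarith
  have hCB0 : 0 ≤ CB := by
    rw [hCBdef]
    have : 0 ≤ 2 * Real.sqrt ⌊2 * M⌋₊ / (P * Real.sqrt (⌊N'⌋₊ / 2)) := by positivity
    have : 0 ≤ 2 * Real.sqrt ⌊2 * M⌋₊ / Real.sqrt (⌊N'⌋₊ / 2) := by positivity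
    positivity
  refine (norm_fiGaussCompl_le hα p M N' θ C P τ).trans ?_
  -- the summand for each `n`
  have hstep : ∀ n ∈ Ioc ⌊N'⌋₊ ⌊(1 + θ) * N'⌋₊, |fiBeta p C P τ n| *
      ∑ z ∈ primaryNormEq n, ∑ uv ∈ (wAnnulus ⌊M⌋₊ ⌊2 * M⌋₊).filter
          (fun uv => ¬ n.Coprime (uv.1 ^ 2 + uv.2 ^ 2).toNat),
        (fiZeta (uv.1 * z.re + uv.2 * z.im) : ℝ) ≤
      τ ^ 2 * CB * #(primaryNormEq n) := by
    intro n hn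
    obtain ⟨hn1, hn2⟩ := mem_Ioc.mp hn
    have hn0 : 0 < n := by omega
    by_cases hb : fiBeta p C P τ n = 0
    · rw [hb, abs_zero, zero_mul]; positivity
    obtain ⟨hsq, hrough, hτn⟩ := of_fiBeta_ne_zero hb
    have hβ : |fiBeta p C P τ n| ≤ τ := (abs_fiBeta_le_card_divisors hp C P τ n).trans hτn
    have hcardp : (#n.primeFactors : ℝ) ≤ τ := by
      refine le_trans ?_ hτn
      have : n.primeFactors ⊆ n.divisors := fun r hr =>
        Nat.mem_divisors.mpr ⟨(Nat.mem_primeFactors.mp hr).2.1, (Nat.mem_primeFactors.mp hr).2.2⟩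
      exact_mod_cast card_le_card this
    have hz : ∀ z ∈ primaryNormEq n, ∑ uv ∈ (wAnnulus ⌊M⌋₊ ⌊2 * M⌋₊).filter
        (fun uv => ¬ n.Coprime (uv.1 ^ 2 + uv.2 ^ 2).toNat),
          (fiZeta (uv.1 * z.re + uv.2 * z.im) : ℝ) ≤ τ * CB := by
      intro z hzmem
      obtain ⟨hzn, -⟩ := mem_primaryNormEq.mp hzmem
      refine (sum_filter_not_coprime_le _ hn0 fun _ => Nat.cast_nonneg _).trans ?_
      have hprime : ∀ r ∈ n.primeFactors, ∑ uv ∈ (wAnnulus ⌊M⌋₊ ⌊2 * M⌋₊).filter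
          (fun uv => (r : ℤ) ∣ uv.1 ^ 2 + uv.2 ^ 2), (fiZeta (uv.1 * z.re + uv.2 * z.im) : ℝ) ≤ CB := by
        intro r hr
        obtain ⟨hrp, hrn, -⟩ := Nat.mem_primeFactors.mp hr
        rw [hCBdef]
        exact sum_filter_dvd_fiZeta_le hY₁ hn1 hn2 hsq hzn hrp hrn hP (hrough r hr)
      calc _ ≤ ∑ r ∈ n.primeFactors, CB := sum_le_sum hprime
        _ = #n.primeFactors * CB := by rw [sum_const, nsmul_eq_mul]
        _ ≤ τ * CB := mul_le_mul_of_nonneg_right hcardp hCB0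
    have hsum0 : 0 ≤ ∑ z ∈ primaryNormEq n, ∑ uv ∈ (wAnnulus ⌊M⌋₊ ⌊2 * M⌋₊).filter
        (fun uv => ¬ n.Coprime (uv.1 ^ 2 + uv.2 ^ 2).toNat),
          (fiZeta (uv.1 * z.re + uv.2 * z.im) : ℝ) :=
      sum_nonneg fun _ _ => sum_nonneg fun _ _ => Nat.cast_nonneg _
    calc |fiBeta p C P τ n| * _ ≤ τ * ∑ z ∈ primaryNormEq n, τ * CB :=
          mul_le_mul hβ (sum_le_sum hz) hsum0 hτ
      _ = τ ^ 2 * CB * #(primaryNormEq n) := by rw [sum_const, nsmul_eq_mul]; ring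
  refine (sum_le_sum hstep).trans ?_
  rw [← mul_sum]
  have hcount : ∑ n ∈ Ioc ⌊N'⌋₊ ⌊(1 + θ) * N'⌋₊, (#(primaryNormEq n) : ℝ) ≤
      (2 * Real.sqrt ⌊(1 + θ) * N'⌋₊ + 1) ^ 2 := by
    have h := sum_card_primaryNormEq_le ⌊N'⌋₊ ⌊(1 + θ) * N'⌋₊
    have h' : ((∑ n ∈ Ioc ⌊N'⌋₊ ⌊(1 + θ) * N'⌋₊, #(primaryNormEq n) : ℕ) : ℝ) ≤
        (((2 * Nat.sqrt ⌊(1 + θ) * N'⌋₊ + 1) ^ 2 : ℕ) : ℝ) := by exact_mod_cast h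
    push_cast at h'
    refine h'.trans ?_
    gcongr
    exact Real.nat_sqrt_le_real_sqrt
  calc τ ^ 2 * CB * ∑ n ∈ Ioc ⌊N'⌋₊ ⌊(1 + θ) * N'⌋₊, (#(primaryNormEq n) : ℝ)
      ≤ τ ^ 2 * CB * (2 * Real.sqrt ⌊(1 + θ) * N'⌋₊ + 1) ^ 2 :=
        mul_le_mul_of_nonneg_left hcount (by positivity)
    _ = _ := by ring

/-! ### The off-axis ("good") sectors: feeding (5.15) -/

/-- The shape of FI (5.15) at fixed `x` and fixed outer data: the bound `K ϑ θ² (MN)^{3/4} (log MN)⁴`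
for every class `z₀`, every sector `(φ, φ + 2πθ]` certified off-axis, every admissible `q`, and
every `|α| ≤ 1` — exactly the tail of `FriedlanderIwaniec1998_bilinear515` after its outer
quantifiers. [cite: FriedlanderIwaniecAnnals1998, (5.15)] -/
def SectorBoundAt (K ϑ θ M N N' C P τ : ℝ) (p : ℝ → ℝ) : Prop :=
  ∀ z₀ : GaussianInt, ∀ φ : ℝ,
    (∃ k : ℤ, k * (π / 2) + π * ϑ < φ ∧ φ + 2 * π * θ < (k + 1) * (π / 2) - π * ϑ) →
  ∀ q : ℝ → ℝ, ContDiff ℝ 2 q → Function.Periodic q (2 * π) →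
    (∀ u, q u ≠ 0 → ∃ k : ℤ, φ < u - 2 * π * k ∧ u - 2 * π * k ≤ φ + 2 * π * θ) →
    (∀ u, |q u| ≤ 1) → (∀ u, |deriv q u| ≤ θ⁻¹) → (∀ u, |deriv (deriv q) u| ≤ θ⁻¹ ^ 2) →
  ∀ α : ℕ → ℂ, (∀ m, ‖α m‖ ≤ 1) →
    ‖fiGaussSector α q p z₀ M N' θ C P τ‖ ≤ K * ϑ * θ ^ 2 * (M * N) ^ (3 / 4 : ℝ) * Real.log (M * N) ^ 4

/-- **A good sector through (5.15)**: if the arc of `q_j = angPiece θ j` is certified off-axis,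
then, after normalising `q_j/(2M_ψ)` to the derivative bounds of (5.12) and splitting into the `≤ 64`
classes modulo `8`, `‖ℬ_{q_j}(M, N)‖ ≤ 64 · 2M_ψ · K ϑ θ² (MN)^{3/4} (log MN)⁴`.
[cite: FriedlanderIwaniecAnnals1998, (5.7), (5.12)-(5.15)] -/
theorem norm_fiFreeSector_angPiece_le {K ϑ θ M N N' C P τ : ℝ} {p : ℝ → ℝ}
    (hS : SectorBoundAt K ϑ θ M N N' C P τ p) (hθ : 0 < θ) (hθ1 : θ ≤ 1 / 2)
    {Mψ : ℝ} (hMψ : 1 ≤ Mψ) (hM' : ∀ s, |deriv Real.smoothTransition s| ≤ Mψ)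
    (hM'' : ∀ s, |deriv (deriv Real.smoothTransition) s| ≤ Mψ)
    {j : ℕ} (hj : ∃ k : ℤ, k * (π / 2) + π * ϑ < angStart θ j ∧
        angStart θ j + 2 * π * θ < (k + 1) * (π / 2) - π * ϑ)
    (hK : 0 ≤ K * ϑ * θ ^ 2 * (M * N) ^ (3 / 4 : ℝ) * Real.log (M * N) ^ 4)
    {α : ℕ → ℂ} (hα : ∀ m, ‖α m‖ ≤ 1) :
    ‖fiFreeSector α (angPiece θ j) p M N' θ C P τ‖ ≤
      64 * (2 * Mψ) * (K * ϑ * θ ^ 2 * (M * N) ^ (3 / 4 : ℝ) * Real.log (M * N) ^ 4) := by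
  set c : ℝ := 2 * Mψ with hc
  have hc0 : 0 < c := by rw [hc]; linarith
  have hc1 : 1 ≤ c := by rw [hc]; linarith
  set q : ℝ → ℝ := fun u => angPiece θ j u / c with hq
  have hqe : angPiece θ j = fun u => c * q u := by
    funext u; rw [hq]; field_simp
  -- `q` is admissible for (5.15)
  have hq_cd : ContDiff ℝ 2 q := (contDiff_angPiece hθ hθ1 j).div_const c
  have hq_per : Function.Periodic q (2 * π) := by
    intro u
    rw [hq]; dsimp only
    rw [angPiece_periodic θ j u]
  have hq_supp : ∀ u, q u ≠ 0 → ∃ k : ℤ, angStart θ j < u - 2 * π * k ∧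
      u - 2 * π * k ≤ angStart θ j + 2 * π * θ := by
    intro u hu
    have : angPiece θ j u ≠ 0 := by
      intro h0; apply hu; rw [hq]; simp [h0]
    exact angPiece_support hθ hθ1 this
  have hq_abs : ∀ u, |q u| ≤ 1 := by
    intro u
    rw [hq]; dsimp only
    rw [abs_div, abs_of_pos hc0, div_le_one hc0]
    exact (abs_angPiece_le_one hθ hθ1 j u).trans hc1
  have hq_d1 : ∀ u, |deriv q u| ≤ θ⁻¹ := by
    intro u
    have e : deriv q u = deriv (angPiece θ j) u / c := by
      rw [hq]; exact deriv_div_const _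
    rw [e, abs_div, abs_of_pos hc0, div_le_iff₀ hc0]
    calc |deriv (angPiece θ j) u| ≤ 2 * Mψ * θ⁻¹ := abs_deriv_angPiece_le hM' (by linarith) hθ hθ1 j u
      _ = θ⁻¹ * c := by rw [hc]; ring
  have hq_d2 : ∀ u, |deriv (deriv q) u| ≤ θ⁻¹ ^ 2 := by
    intro u
    have e1 : deriv q = fun u => deriv (angPiece θ j) u / c := by
      funext u; rw [hq]; exact deriv_div_const _
    have e : deriv (deriv q) u = deriv (deriv (angPiece θ j)) u / c := by
      rw [e1]; exact deriv_div_const _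
    rw [e, abs_div, abs_of_pos hc0, div_le_iff₀ hc0]
    calc |deriv (deriv (angPiece θ j)) u| ≤ 2 * Mψ * θ⁻¹ ^ 2 :=
          abs_deriv_deriv_angPiece_le hM'' (by linarith) hθ hθ1 j u
      _ = θ⁻¹ ^ 2 * c := by rw [hc]; ring
  -- class by class
  rw [fiFreeSector_eq_sum_fiGaussSector]
  refine (norm_sum_le _ _).trans ?_
  have hterm : ∀ z₀ ∈ gaussReps8, ‖fiGaussSector α (angPiece θ j) p z₀ M N' θ C P τ‖ ≤
      c * (K * ϑ * θ ^ 2 * (M * N) ^ (3 / 4 : ℝ) * Real.log (M * N) ^ 4) := by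
    intro z₀ _
    rw [hqe, fiGaussSector_const_mul, norm_mul, Complex.norm_real, Real.norm_eq_abs, abs_of_pos hc0]
    exact mul_le_mul_of_nonneg_left
      (hS z₀ (angStart θ j) hj q hq_cd hq_per hq_supp hq_abs hq_d1 hq_d2 α hα) hc0.le
  calc ∑ z₀ ∈ gaussReps8, ‖fiGaussSector α (angPiece θ j) p z₀ M N' θ C P τ‖
      ≤ ∑ z₀ ∈ gaussReps8, c * (K * ϑ * θ ^ 2 * (M * N) ^ (3 / 4 : ℝ) * Real.log (M * N) ^ 4) :=
        sum_le_sum hterm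
    _ = #gaussReps8 * (c * (K * ϑ * θ ^ 2 * (M * N) ^ (3 / 4 : ℝ) * Real.log (M * N) ^ 4)) := by
        rw [sum_const, nsmul_eq_mul]
    _ ≤ 64 * (c * (K * ϑ * θ ^ 2 * (M * N) ^ (3 / 4 : ℝ) * Real.log (M * N) ^ 4)) := by
        refine mul_le_mul_of_nonneg_right ?_ (mul_nonneg hc0.le hK)
        exact_mod_cast card_gaussReps8_le
    _ = _ := by ring

/-! ### The splitting inequality -/

/-- **`ℬ*(M, N)` split** ((5.6), (5.10), (5.12)): for `P > 2` and any set `G` of arcs,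
`‖ℬ*(M, N)‖ ≤ Σ_{j ∈ G} ‖ℬ_{q_j}(M, N)‖ + ‖ℬ_{q_bad}(M, N)‖ + ‖ℬ̃(M, N)‖` with
`q_bad = Σ_{j ∉ G} q_j` the total weight of the remaining arcs.
[cite: FriedlanderIwaniecAnnals1998, (5.6), (5.10), (5.12)] -/
theorem norm_fiBilinearStar_le_split (α : ℕ → ℂ) (p : ℝ → ℝ) {M N' θ C P τ : ℝ} (hP : 2 < P)
    (hθ : 0 < θ) (hθ1 : θ ≤ 1 / 2) {G : Finset ℕ} (hG : G ⊆ range (angCount θ)) :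
    ‖fiBilinearStar α p M N' θ C P τ‖ ≤
      ∑ j ∈ G, ‖fiFreeSector α (angPiece θ j) p M N' θ C P τ‖ +
        ‖fiFreeSector α (fun u => ∑ j ∈ range (angCount θ) \ G, angPiece θ j u) p M N' θ C P τ‖ +
        ‖fiGaussCompl α p M N' θ C P τ‖ := by
  have e1 : fiBilinearStar α p M N' θ C P τ =
      fiFreeSector α (fun _ => 1) p M N' θ C P τ - fiGaussCompl α p M N' θ C P τ := by
    rw [fiBilinearStar_eq_fiGaussStar α p M N' θ C τ hP, ← fiGaussStar_add_fiGaussCompl]; ring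
  have e2 : fiFreeSector α (fun _ => 1) p M N' θ C P τ =
      ∑ j ∈ G, fiFreeSector α (angPiece θ j) p M N' θ C P τ +
        fiFreeSector α (fun u => ∑ j ∈ range (angCount θ) \ G, angPiece θ j u) p M N' θ C P τ := by
    rw [fiFreeSector_one_eq_sum_angPiece hθ hθ1, fiFreeSector_sum, ← sum_sdiff hG, add_comm]
  rw [e1, e2]
  refine (norm_sub_le _ _).trans ?_
  gcongr
  exact norm_add_le_of_le (norm_sum_le _ _) le_rfl


/-- The §5 counterpart of `BilinBoundAt`: (5.15) at fixed `x, P, N, C` — for all `M` with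
`x(log x)^{-A₂} < MN < x`, all `N < N' < 2N` and every admissible `p` ((4.12)–(4.14)), the sector
bound `SectorBoundAt K ϑ θ M N N' C P τ p` (every class `z₀`, every off-axis sector, every admissible
`q`, every `|α| ≤ 1`). A parametrised predicate (hypothesis shape), not a claim.
[cite: FriedlanderIwaniecAnnals1998, (5.15) with (4.12)-(4.14), (4.18)-(4.19)] -/
def Sector515At (x P N C A₂ θ τ ϑ K : ℝ) : Prop :=
  ∀ M : ℝ, x / Real.log x ^ A₂ < M * N → M * N < x →
  ∀ N' : ℝ, N < N' → N' < 2 * N →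
  ∀ p : ℝ → ℝ, ContDiff ℝ 2 p →
    (∀ u, p u ≠ 0 → N' < u ∧ u ≤ (1 + θ) * N') →
    (∀ u, |p u| ≤ 1) →
    (∀ u, |deriv p u| ≤ (θ * N)⁻¹) →
    (∀ u, |deriv (deriv p) u| ≤ (θ * N)⁻¹ ^ 2) →
  SectorBoundAt K ϑ θ M N N' C P τ p

end Literature.NumberTheory.Sieve.FriedlanderIwaniecPrimes
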